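import Literature.NumberTheory.GaloisCohomology.Howard2004.DVRKolyvaginBound
import Literature.NumberTheory.GaloisCohomology.Howard2004.KolyvaginSystemScalars
import Literature.NumberTheory.GaloisCohomology.Howard2004.QuotCartesianReductionProofs
import Literature.NumberTheory.GaloisCohomology.Howard2004.TowerMorphismPushforward
import Literature.NumberTheory.GaloisCohomology.Howard2004.SelmerAScalarStabilityProofs
import Mathlib.RingTheory.Nakayama
import Mathlib.RingTheory.OrderOfVanishing.Basic
import HarnessLib

/-!
# Howard 2004, Theorem 1.6.1 — PROVED STEPS of the printed proof (arXiv:1202.6340, p. 12 L29–55)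

Source: B. Howard, *The Heegner point Kolyvagin system*, Compositio Math. **140** (2004) 1439–1472,
Thm. 1.6.1 (= arXiv:1202.6340 Thm. 2.6.1, p. 11 L23–28; proof p. 12 L29–55).  The theorem itself is
the CITE-ONLY named fact `thm161_dvrKolyvaginBound` of `Howard2004/DVRKolyvaginBound.lean`
(consumers: the μ-crux `MuInequalityCoherentPair` of routes PrintX9 / PrintX10b, binder `stub_h161`;
`HowardDVRKolyvaginBound`).  Its printed proof runs through the whole of Howard §1.3–1.6 (journal
numbering; arXiv = journal + 1 in the section index): Lemma 1.3.3 (control,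
`H¹_F(K, T/𝔪^i T) ≅ H¹_F(K, T)[𝔪^i]`), Thm. 1.4.2 with Def. 1.5.4 / Prop. 1.5.5 (the structure
`H¹_F(K, T) ≅ R^ε ⊕ M ⊕ M`, the stub `𝔪^{λ} H¹`, `λ = len M`) and Lemma 1.6.4 (`κ_n^{(k)} ∈
Stub^{(k)}(n) ⊗ G_n`, via Čebotarev (Lemma 1.6.2), the generalized Cassels–Tate pairing of §1.4 and
global duality) — none of which the tree has.  THIS FILE proves, sorry-free and without any new
named fact, the steps of the CLOSING ARGUMENT (p. 12 L29–55) that are already within reach: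

* §A [p. 12 L29–31] «Since `H¹_F(K,T) ≅ lim H¹_F(K,T^{(k)})`, we must have `κ_1^{(k)}` nonzero for
  `k ≫ 0`»: on the tree's objects (`DVRSetting.KolyvaginSystem`), `κ.one ≠ 0 → ∃ k₀, ∀ k ≥ k₀,
  κ.one k ≠ 0`, from the compatibility `one_mem : κ_1 ∈ lim`.
* §B [p. 12 L33–34 with Def. 1.5.4] the algebra behind «`κ_1^{(k)} ∈ Stub^{(k)}` and in particular
  `Stub^{(k)} ≠ 0` [forces `ε = 1`]»: over a local ring, `𝔪^{len M} · M = 0` for a module of finite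
  length (Nakayama + strict monotonicity of length), so `𝔪^{λ}(R^ε ⊕ M ⊕ M) = 𝔪^{λ} R^ε`.
* §C [p. 12 L50–55] the algebra behind «by the injectivity of `H¹_F(K,T)/𝔪^k H¹_F(K,T) →
  H¹_F(K,T^{(k)})`, `κ_1 ∈ 𝔪^λ H¹_F(K,T)`.  The claim follows.»: if the image `x̄` of the generator
  has annihilator inside `(π^k)`, the module is killed by `π^k`, and `u π^a · x̄ ∈ π^λ · H`
  (`λ ≤ k`), then `λ ≤ a`; and `len_R (R ⧸ (u π^a)) = a` for a uniformizer `π` (Mathlib `Ring.ord`),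
  whence `len_R M ≤ len_R (R ⧸ r₁ R)` in the currency of `DVRSetting.Conclusion`.

HONEST FRAMING: nothing here proves `thm161_dvrKolyvaginBound`; the missing printed inputs are named
above (and typed, with locators, in the evidence note of item stmt-BirchSwinnertonDyer-22642 filed
with this file).  No summit statement is proved; the Birch–Swinnerton-Dyer conjecture is not proved
by any of this.  No `sorry`, no new axiom, no instance, no notation, no named fact.
-/

set_option autoImplicit false

noncomputable section

open Function NumberField IsDedekindDomain Field
open scoped NumberField ContRepresentation Classical

namespace Literature.NumberTheory.GaloisCohomology.Howard2004

open Literature.NumberTheory.GaloisRepresentations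
open Literature.NumberTheory.GaloisRepresentations.DiscreteGaloisModule

/-! ## §A. «`κ_1 ≠ 0` in `H¹_F(K, T) = lim_k H¹_F(K, T^{(k)})` forces `κ_1^{(k)} ≠ 0` for `k ≫ 0`» (p. 12 L29–31) -/

section StepOne

namespace AdicTower

variable {K : Type} [Field K] [NumberField K] {R : Type} [CommRing R] [IsLocalRing R]
  {N : ℕ → Type} [∀ k, AddCommGroup (N k)] [∀ k, TopologicalSpace (N k)]
  [∀ k, DiscreteTopology (N k)] [∀ k, Module R (N k)]

omit [NumberField K] in
/-- A compatible family `x ∈ lim_k H¹(K, T_k)` that vanishes at level `k` vanishes at every level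
`j ≤ k` (the reductions are homomorphisms). [cite: Howard2004HeegnerKolyvagin, §1.6 (arXiv p. 12, L29–31)] -/
theorem limitH1_apply_eq_zero_of_le (T : AdicTower K R N) {x : ∀ k, galoisCohomology (T.ρ k) 1}
    (hx : x ∈ T.limitH1) {j k : ℕ} (hjk : j ≤ k) (h : x k = 0) : x j = 0 := by
  obtain ⟨d, rfl⟩ := Nat.exists_eq_add_of_le hjk
  induction d with
  | zero => simpa using h
  | succ d ih =>
    refine ih (Nat.le_add_right j d) ?_
    have hc : T.redH1 (j + d) (x (j + d + 1)) = x (j + d) := hx (j + d)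
    have h' : x (j + d + 1) = 0 := h
    rw [← hc, h', map_zero]

omit [NumberField K] in
/-- A non-zero compatible family `x ∈ lim_k H¹(K, T_k)` has ALL its components non-zero from some
level on. [cite: Howard2004HeegnerKolyvagin, §1.6 (arXiv p. 12, L29–31)] -/
theorem exists_forall_le_apply_ne_zero_of_mem_limitH1 (T : AdicTower K R N)
    {x : ∀ k, galoisCohomology (T.ρ k) 1} (hx : x ∈ T.limitH1) (h : x ≠ 0) :
    ∃ k₀ : ℕ, ∀ k, k₀ ≤ k → x k ≠ 0 := by
  obtain ⟨k₀, hk₀⟩ : ∃ k₀, x k₀ ≠ 0 := by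
    by_contra hc
    push Not at hc
    exact h (funext hc)
  exact ⟨k₀, fun k hk hk0 => hk₀ (T.limitH1_apply_eq_zero_of_le hx hk hk0)⟩

end AdicTower

namespace DVRSetting.KolyvaginSystem

variable {p : ℕ} [Fact p.Prime] {K : Type} [Field K] [NumberField K]
  {R : Type} [CommRing R] [IsDomain R] [IsDiscreteValuationRing R] [Algebra ℤ_[p] R]
  {N : ℕ → Type} [∀ k, AddCommGroup (N k)] [∀ k, TopologicalSpace (N k)]
  [∀ k, DiscreteTopology (N k)] [∀ k, Module R (N k)]
  {Rk : ℕ → Type} [∀ k, CommRing (Rk k)] [∀ k, IsLocalRing (Rk k)] [∀ k, TopologicalSpace (Rk k)]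
  [∀ k, DiscreteTopology (Rk k)] [∀ k, Algebra ℤ_[p] (Rk k)] [∀ k, Algebra R (Rk k)]
  [∀ k, Module (Rk k) (N k)] [∀ k, IsScalarTower R (Rk k) (N k)]
  {Nbar : Type} [AddCommGroup Nbar] [TopologicalSpace Nbar] [DiscreteTopology Nbar]
  [∀ k, Module (Rk k) Nbar]
  {Nq : ℕ → Finset (HeightOneSpectrum (𝓞 K)) → Type} [∀ k n, AddCommGroup (Nq k n)]
  [∀ k n, TopologicalSpace (Nq k n)] [∀ k n, DiscreteTopology (Nq k n)]
  [∀ k n, Module (Rk k) (Nq k n)] [∀ k n, Module R (Nq k n)]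
  [∀ k n, IsScalarTower R (Rk k) (Nq k n)]
  {S : DVRSetting p K R N Rk Nbar Nq}

/-- `κ_1 ∈ lim_k H¹(K, T^{(k)})`: the level classes `κ_1^{(k)}` are compatible under the reductions.
[cite: Howard2004HeegnerKolyvagin, §1.6 (arXiv p. 12, L29–33)] -/
theorem one_mem_limitH1 (κ : S.KolyvaginSystem) : κ.one ∈ S.T.limitH1 :=
  (AddSubgroup.mem_inf.mp κ.one_mem).1

/-- `κ_1^{(k+1)} ↦ κ_1^{(k)}` under the reduction `H¹(K, T^{(k+1)}) → H¹(K, T^{(k)})`.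
[cite: Howard2004HeegnerKolyvagin, §1.6 (arXiv p. 12, L29–33)] -/
theorem redH1_one (κ : S.KolyvaginSystem) (k : ℕ) : S.T.redH1 k (κ.one (k + 1)) = κ.one k :=
  ((S.T.mem_limitSelmer_iff _ _).mp κ.one_mem).1 k

/-- Every level class `κ_1^{(k)}` is a Selmer class for `F` on `T^{(k)}`.
[cite: Howard2004HeegnerKolyvagin, §1.6 (arXiv p. 12, L29–33)] -/
theorem one_mem_selmerGroup (κ : S.KolyvaginSystem) (k : ℕ) :
    κ.one k ∈ ((S.t k).cond).selmerGroup :=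
  ((S.T.mem_limitSelmer_iff _ _).mp κ.one_mem).2 k

/-- If `κ_1^{(k)} = 0` then `κ_1^{(j)} = 0` for every `j ≤ k`.
[cite: Howard2004HeegnerKolyvagin, §1.6 (arXiv p. 12, L29–31)] -/
theorem one_apply_eq_zero_of_le (κ : S.KolyvaginSystem) {j k : ℕ} (hjk : j ≤ k)
    (h : κ.one k = 0) : κ.one j = 0 :=
  S.T.limitH1_apply_eq_zero_of_le κ.one_mem_limitH1 hjk h

/-- **«Since `H¹_F(K, T) ≅ lim H¹_F(K, T^{(k)})`, we must have `κ_1^{(k)}` nonzero for `k ≫ 0`.»**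
(first sentence of the proof of Thm. 1.6.1).
[cite: Howard2004HeegnerKolyvagin, Thm. 1.6.1, proof (arXiv p. 12, L29–31)] -/
theorem exists_forall_le_one_apply_ne_zero (κ : S.KolyvaginSystem) (h : κ.one ≠ 0) :
    ∃ k₀ : ℕ, ∀ k, k₀ ≤ k → κ.one k ≠ 0 :=
  S.T.exists_forall_le_apply_ne_zero_of_mem_limitH1 κ.one_mem_limitH1 h

end DVRSetting.KolyvaginSystem

end StepOne

/-! ## §B. `𝔪^{len M} · M = 0` over a local ring («`Stub^{(k)} = 𝔪^{λ^{(k)}} H¹`, `λ^{(k)} = len M^{(k)}`», Def. 1.5.4; used at p. 12 L33–34) -/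

section LengthKills

variable {R : Type*} [CommRing R] [IsLocalRing R] {M : Type*} [AddCommGroup M] [Module R M]

/-- Over a local ring, a submodule `N` of finite length `≤ n` (inside a module of finite length) is
killed by `𝔪^n`: Nakayama (`𝔪N = N ⇒ N = 0`) and strict monotonicity of the length give
`𝔪^{n+1} N = 𝔪^n (𝔪 N)` with `len(𝔪N) < len N`.  This is the algebra that turns the structure
`H¹_F ≅ R^ε ⊕ M ⊕ M` of Thm. 1.4.2 into «`Stub = 𝔪^{len M} H¹ = 𝔪^{len M} R^ε`» (Def. 1.5.4), hence
«`Stub^{(k)} ≠ 0` forces `ε = 1`» in the proof of Thm. 1.6.1.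
[cite: Howard2004HeegnerKolyvagin, Def. 1.5.4 (arXiv Def. 2.5.4, p. 10 L57–62) and Thm. 1.6.1, proof (arXiv p. 12, L33–34)] -/
theorem maximalIdeal_pow_smul_eq_bot_of_length_le [IsNoetherian R M] [IsArtinian R M] :
    ∀ (n : ℕ) (N : Submodule R M), Module.length R N ≤ n →
      IsLocalRing.maximalIdeal R ^ n • N = ⊥ := by
  intro n
  induction n with
  | zero =>
    intro N hN
    have h0 : Module.length R N = 0 := nonpos_iff_eq_zero.mp (by exact_mod_cast hN)
    have hs : Subsingleton N := Module.length_eq_zero_iff.mp h0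
    have hNb : N = ⊥ := by
      by_contra hne
      exact not_nontrivial_iff_subsingleton.mpr hs (Submodule.nontrivial_iff_ne_bot.mpr hne)
    simp [hNb]
  | succ n ih =>
    intro N hN
    by_cases hNb : N = ⊥
    · simp [hNb]
    have hlt : IsLocalRing.maximalIdeal R • N < N := by
      refine lt_of_le_of_ne Submodule.smul_le_right fun heq => hNb ?_
      exact Submodule.eq_bot_of_le_smul_of_le_jacobson_bot (IsLocalRing.maximalIdeal R) N
        (IsNoetherian.noetherian N) heq.ge (IsLocalRing.maximalIdeal_le_jacobson ⊥)
    have hlen : Module.length R ↥(IsLocalRing.maximalIdeal R • N) < Module.length R N := by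
      rw [Module.length_submodule, Module.length_submodule]
      exact Submodule.height_strictMono hlt
    have hle : Module.length R ↥(IsLocalRing.maximalIdeal R • N) ≤ n := by
      have h1 : Module.length R ↥(IsLocalRing.maximalIdeal R • N) < (n : ℕ∞) + 1 :=
        lt_of_lt_of_le hlen (by exact_mod_cast hN)
      exact (ENat.lt_add_one_iff (ENat.coe_ne_top n)).mp h1
    rw [pow_succ, Submodule.mul_smul]
    exact ih _ hle

/-- `𝔪^{len M} · M = 0` for a module of finite length over a local ring.
[cite: Howard2004HeegnerKolyvagin, Def. 1.5.4 (arXiv p. 10, L57–62); Thm. 1.6.1, proof (arXiv p. 12, L33–34)] -/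
theorem maximalIdeal_pow_length_smul_top_eq_bot [IsNoetherian R M] [IsArtinian R M] :
    IsLocalRing.maximalIdeal R ^ (Module.length R M).toNat • (⊤ : Submodule R M) = ⊥ := by
  refine maximalIdeal_pow_smul_eq_bot_of_length_le _ ⊤ ?_
  rw [Submodule.topEquiv.length_eq, ENat.coe_toNat Module.length_ne_top]

/-- Elementwise form: every `r ∈ 𝔪^{len M}` kills `M`.
[cite: Howard2004HeegnerKolyvagin, Def. 1.5.4 (arXiv p. 10, L57–62); Thm. 1.6.1, proof (arXiv p. 12, L33–34)] -/
theorem smul_eq_zero_of_mem_maximalIdeal_pow_length [IsNoetherian R M] [IsArtinian R M]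
    {r : R} (hr : r ∈ IsLocalRing.maximalIdeal R ^ (Module.length R M).toNat) (m : M) :
    r • m = 0 := by
  have h := maximalIdeal_pow_length_smul_top_eq_bot (R := R) (M := M)
  rw [Submodule.eq_bot_iff] at h
  exact h _ (Submodule.smul_mem_smul hr Submodule.mem_top)

/-- In the structure `H ≅ R^ε ⊕ (M ⊕ M)` (Thm. 1.4.2), the stub `𝔪^{len M} H` lies in the `R^ε`
summand: an element `π^λ · (e, m₁, m₂)` with `π^λ ∈ 𝔪^{len M}` is `(π^λ e, 0, 0)`.  Hence «in
particular `Stub^{(k)} ≠ 0`» forces the free summand to be non-zero, i.e. `ε = 1`.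
[cite: Howard2004HeegnerKolyvagin, Thm. 1.4.2 and Def. 1.5.4 (arXiv pp. 8, 10); Thm. 1.6.1, proof (arXiv p. 12, L33–34)] -/
theorem stub_subsingleton_of_free_part_subsingleton {E : Type*} [AddCommGroup E] [Module R E]
    [IsNoetherian R M] [IsArtinian R M] [Subsingleton E]
    {r : R} (hr : r ∈ IsLocalRing.maximalIdeal R ^ (Module.length R M).toNat)
    (x : E × (M × M)) : r • x = 0 := by
  obtain ⟨e, m₁, m₂⟩ := x
  simp only [Prod.smul_mk, Prod.mk_eq_zero]
  exact ⟨Subsingleton.elim _ _, smul_eq_zero_of_mem_maximalIdeal_pow_length hr m₁,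
    smul_eq_zero_of_mem_maximalIdeal_pow_length hr m₂⟩

end LengthKills

/-! ## §C. The length bound transfer (p. 12 L50–55) -/

section LengthBound

variable {R : Type*} [CommRing R] [IsDomain R] {H : Type*} [AddCommGroup H] [Module R H]

/-- **The divisibility step of the proof of Thm. 1.6.1** in the abstract: `H` (the level Selmer
group `H¹_F(K, T^{(k)})`) is killed by `π^k`; `x̄` (the image of the generator `x` of the free
rank-one `H¹_F(K, T)`) has annihilator inside `(π^k)` — this is «the injectivity of
`H¹_F(K,T)/𝔪^k H¹_F(K,T) → H¹_F(K,T^{(k)})`»; and the image `u π^a · x̄` of `κ_1 = u π^a · x` lies in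
the stub `π^λ H` («`κ_1^{(k)} ∈ 𝔪^λ H¹_F(K, T^{(k)})`», Lemma 1.6.4 with `n = 1`), `λ ≤ k`.  Then
`λ ≤ a`, i.e. «`κ_1 ∈ 𝔪^λ H¹_F(K, T)`».
[cite: Howard2004HeegnerKolyvagin, Thm. 1.6.1, proof (arXiv p. 12, L50–55)] -/
theorem le_of_unit_mul_pow_smul_mem_pow_smul {π : R} (hπ0 : π ≠ 0) (hπu : ¬ IsUnit π)
    {k lam a : ℕ} (hlam : lam ≤ k) (hH : ∀ h : H, π ^ k • h = 0)
    {x : H} (hx : ∀ r : R, r • x = 0 → π ^ k ∣ r) {u : R} (hu : IsUnit u)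
    (hmem : ∃ y : H, (u * π ^ a) • x = π ^ lam • y) : lam ≤ a := by
  obtain ⟨y, hy⟩ := hmem
  have hkill : (π ^ (k - lam) * (u * π ^ a)) • x = 0 := by
    rw [mul_smul, hy, ← mul_smul, ← pow_add, Nat.sub_add_cancel hlam, hH]
  have hdvd : π ^ k ∣ π ^ (k - lam) * (u * π ^ a) := hx _ hkill
  have hdvd' : π ^ k ∣ π ^ (k - lam + a) := by
    have hrw : π ^ (k - lam) * (u * π ^ a) = u * π ^ (k - lam + a) := by ring
    rw [hrw] at hdvd
    exact (hu.dvd_mul_left).mp hdvd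
  have hle : k ≤ k - lam + a := (pow_dvd_pow_iff hπ0 hπu).mp hdvd'
  omega

/-- `len_R (R ⧸ (u π^a)) = a` for a uniformizer `π` of the discrete valuation ring `R` and a unit
`u` (Mathlib's order of vanishing `Ring.ord`): the right-hand side `len_R (R ⧸ r₁R)` of the bound of
`DVRSetting.Conclusion` for `κ_1 = r₁ · x`, `r₁ = u π^a`.
[cite: Howard2004HeegnerKolyvagin, Thm. 1.6.1 (arXiv p. 11, L27–28)] -/
theorem length_quotient_span_unit_mul_uniformizer_pow [IsDiscreteValuationRing R] {π : R}
    (hπ : Irreducible π) {u : R} (hu : IsUnit u) (a : ℕ) :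
    Module.length R (R ⧸ Ideal.span {u * π ^ a}) = a := by
  change Ring.ord R (u * π ^ a) = a
  rw [Ring.ord_mul_of_isUnit_left hu, Ring.ord_pow (mem_nonZeroDivisors_of_ne_zero hπ.ne_zero),
    Ring.ord_of_irreducible hπ]
  simp

/-- **«The claim follows»**: with `λ = len_R M` and `κ_1 = u π^a · x`, the two preceding facts give
`len_R M ≤ len_R (R ⧸ (u π^a))`, the bound of Thm. 1.6.1 in the currency of `DVRSetting.Conclusion`.
[cite: Howard2004HeegnerKolyvagin, Thm. 1.6.1, proof (arXiv p. 12, L50–55)] -/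
theorem length_le_length_quotient_of_stub [IsDiscreteValuationRing R] {π : R} (hπ : Irreducible π)
    {M : Type*} [AddCommGroup M] [Module R M] {k lam a : ℕ} (hM : Module.length R M = lam)
    (hlam : lam ≤ k) (hH : ∀ h : H, π ^ k • h = 0)
    {x : H} (hx : ∀ r : R, r • x = 0 → π ^ k ∣ r) {u : R} (hu : IsUnit u)
    (hmem : ∃ y : H, (u * π ^ a) • x = π ^ lam • y) :
    Module.length R M ≤ Module.length R (R ⧸ Ideal.span {u * π ^ a}) := by
  rw [hM, length_quotient_span_unit_mul_uniformizer_pow hπ hu a]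
  exact_mod_cast le_of_unit_mul_pow_smul_mem_pow_smul hπ.ne_zero hπ.not_isUnit hlam hH hx hu hmem

end LengthBound

/-! ## §D. «`H¹_F(K, T)` is the `π`-adic Tate module of `H¹_F(K, A) ≅ 𝒟 ⊕ M ⊕ M`, and is therefore a free rank-one `R`-module» (p. 12 L44–46), abstract form

The compatible families of an inverse system `(E_k, red_k)` of CYCLIC modules `E_k ≅ R/𝔪^{e_k}`
with surjective transitions over an `𝔪`-adically complete local ring `R` form a free `R`-module of
rank one: a compatible system of generators exists (units lift along `R ↠ R/𝔪^{e_k}`), its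
annihilator is `⋂_k 𝔪^{e_k} = 0` (Hausdorff), and every compatible family is a multiple of it
(precompleteness).  In the proof of Thm. 1.6.1 the `E_k` are the stable images
`⋂_j red(H¹_F(K, T^{(j)})) ⊂ H¹_F(K, T^{(k)}) ≅ R/𝔪^{e_k} ⊕ M^{(k)} ⊕ M^{(k)}` — the levels of the
Tate module of the `𝒟`-summand — an identification that rests on Lemma 1.3.3 and Thm. 1.4.2 and is
NOT made here; the statements below are pure commutative algebra (no `def`, no instance). -/

section TateModule

variable {R : Type*} [CommRing R] [IsLocalRing R]

/-- Over a local ring: if `(1 - w v) · g = 0` for an element `g` whose annihilator is contained in `𝔪`,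
then `v` is a unit. [folklore] -/
private theorem isUnit_of_one_sub_mul_mem_maximalIdeal {w v : R}
    (h : 1 - w * v ∈ IsLocalRing.maximalIdeal R) : IsUnit v := by
  by_contra hv
  have hv' : w * v ∈ IsLocalRing.maximalIdeal R :=
    Ideal.mul_mem_left _ _ ((IsLocalRing.mem_maximalIdeal _).mpr hv)
  have h1 : (1 : R) ∈ IsLocalRing.maximalIdeal R := by
    have := Ideal.add_mem _ h hv'
    rwa [sub_add_cancel] at this
  exact (IsLocalRing.maximalIdeal.isMaximal R).ne_top (Ideal.eq_top_of_isUnit_mem _ h1 isUnit_one)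

variable {E₀ E₁ : Type*} [AddCommGroup E₀] [Module R E₀] [AddCommGroup E₁] [Module R E₁]

/-- **Compatible generators, one step.**  `E₀ = R·g₀` cyclic with annihilator `𝔪^{n₀}`, `n₀ ≥ 1`,
`E₁` cyclic with annihilator `𝔪^{n₁}`, `red : E₁ ↠ E₀` onto: then `E₁` has a generator `g₁` with
annihilator `𝔪^{n₁}` AND `red g₁ = g₀` (adjust any generator by a unit: `red h = v g₀` with `v`
a unit since `red h` also generates).  The levelwise step of «`H¹_F(K,T)` is the `π`-adic Tate
module … free of rank one». [cite: Howard2004HeegnerKolyvagin, Thm. 1.6.1, proof (arXiv p. 12, L44–46)] -/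
theorem exists_generator_red_eq (red : E₁ →ₗ[R] E₀) (hred : Function.Surjective red)
    {n₀ n₁ : ℕ} (hn₀ : 0 < n₀) {g₀ : E₀}
    (hg₀ : ∀ r : R, r • g₀ = 0 ↔ r ∈ IsLocalRing.maximalIdeal R ^ n₀)
    (hg₀gen : ∀ y : E₀, ∃ r : R, y = r • g₀)
    (h₁ : ∃ g₁ : E₁, (∀ r : R, r • g₁ = 0 ↔ r ∈ IsLocalRing.maximalIdeal R ^ n₁) ∧
      ∀ y : E₁, ∃ r : R, y = r • g₁) :
    ∃ g₁ : E₁, (∀ r : R, r • g₁ = 0 ↔ r ∈ IsLocalRing.maximalIdeal R ^ n₁) ∧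
      (∀ y : E₁, ∃ r : R, y = r • g₁) ∧ red g₁ = g₀ := by
  obtain ⟨h, hhann, hhgen⟩ := h₁
  obtain ⟨v, hv⟩ := hg₀gen (red h)
  obtain ⟨z, hz⟩ := hred g₀
  obtain ⟨w, hw⟩ := hhgen z
  -- `g₀ = red z = red (w h) = w v g₀`, so `(1 - w v) g₀ = 0`, `1 - w v ∈ 𝔪^{n₀} ⊆ 𝔪`, `v` is a unit
  have hwv : (1 - w * v) • g₀ = 0 := by
    rw [sub_smul, one_smul, mul_smul, ← hv, ← map_smul, ← hw, hz, sub_self]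
  have hunit : IsUnit v := by
    refine isUnit_of_one_sub_mul_mem_maximalIdeal (w := w) ?_
    exact Ideal.pow_le_self hn₀.ne' ((hg₀ _).mp hwv)
  obtain ⟨vu, rfl⟩ := hunit
  refine ⟨((vu⁻¹ : Rˣ) : R) • h, fun r => ?_, fun y => ?_, ?_⟩
  · rw [smul_smul, hhann]
    exact Ideal.mul_unit_mem_iff_mem _ (Units.isUnit _)
  · obtain ⟨r, hr⟩ := hhgen y
    refine ⟨r * (vu : R), ?_⟩
    rw [smul_smul, mul_assoc, Units.mul_inv, mul_one, hr]
  · rw [map_smul, hv, smul_smul, Units.inv_mul, one_smul]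

variable {E : ℕ → Type*} [∀ k, AddCommGroup (E k)] [∀ k, Module R (E k)]

/-- **A compatible system of generators** of an inverse system of cyclic modules `E_k ≅ R/𝔪^{e_k}`
(`e_k ≥ 1`) with surjective transitions. [cite: Howard2004HeegnerKolyvagin, Thm. 1.6.1, proof (arXiv p. 12, L44–46)] -/
theorem exists_compatible_generators (red : ∀ k, E (k + 1) →ₗ[R] E k)
    (hred : ∀ k, Function.Surjective (red k)) (e : ℕ → ℕ) (he0 : ∀ k, 0 < e k)
    (hE : ∀ k, ∃ g : E k, (∀ r : R, r • g = 0 ↔ r ∈ IsLocalRing.maximalIdeal R ^ e k) ∧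
      ∀ y : E k, ∃ r : R, y = r • g) :
    ∃ g : ∀ k, E k, (∀ k, ∀ r : R, r • g k = 0 ↔ r ∈ IsLocalRing.maximalIdeal R ^ e k) ∧
      (∀ k, ∀ y : E k, ∃ r : R, y = r • g k) ∧ ∀ k, red k (g (k + 1)) = g k := by
  let P : ∀ k, E k → Prop := fun k g =>
    (∀ r : R, r • g = 0 ↔ r ∈ IsLocalRing.maximalIdeal R ^ e k) ∧ ∀ y : E k, ∃ r : R, y = r • g
  have step : ∀ (k : ℕ) (gk : {g : E k // P k g}),
      ∃ g' : {g : E (k + 1) // P (k + 1) g}, red k g'.1 = gk.1 := by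
    intro k gk
    obtain ⟨g₁, h1, h2, h3⟩ :=
      exists_generator_red_eq (red k) (hred k) (he0 k) gk.2.1 gk.2.2 (hE (k + 1))
    exact ⟨⟨g₁, h1, h2⟩, h3⟩
  choose next hnext using step
  obtain ⟨g0, hg0⟩ := hE 0
  let g : ∀ k, {g : E k // P k g} := fun k => Nat.rec ⟨g0, hg0⟩ (fun k gk => next k gk) k
  exact ⟨fun k => (g k).1, fun k => (g k).2.1, fun k => (g k).2.2, fun k => hnext k (g k)⟩

/-- **The annihilator of a compatible system of generators is `⋂_k 𝔪^{e_k} = 0`** when `e_k → ∞` and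
`R` is `𝔪`-adically Hausdorff (a coefficient ring is complete, in particular Hausdorff).
[cite: Howard2004HeegnerKolyvagin, Thm. 1.6.1, proof (arXiv p. 12, L44–46)] -/
theorem eq_zero_of_smul_generators_eq_zero [IsHausdorff (IsLocalRing.maximalIdeal R) R]
    (e : ℕ → ℕ) (he : ∀ n : ℕ, ∃ k, n ≤ e k) {g : ∀ k, E k}
    (hg : ∀ k, ∀ r : R, r • g k = 0 ↔ r ∈ IsLocalRing.maximalIdeal R ^ e k)
    {r : R} (hr : ∀ k, r • g k = 0) : r = 0 := by
  refine IsHausdorff.haus ‹_› r fun n => ?_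
  obtain ⟨k, hk⟩ := he n
  have hrk : r ∈ IsLocalRing.maximalIdeal R ^ n :=
    Ideal.pow_le_pow_right hk ((hg k r).mp (hr k))
  refine SModEq.zero.mpr ?_
  simpa using Submodule.smul_mem_smul hrk (Submodule.mem_top : (1 : R) ∈ (⊤ : Submodule R R))

/-- The coefficients of a compatible family along a compatible system of generators form an
`𝔪`-adic Cauchy sequence: `y_k = r_k g_k`, `red y_{k+1} = y_k` give `r_n - r_m ∈ 𝔪^{e_m}` for
`m ≤ n` (`e` monotone). [cite: Howard2004HeegnerKolyvagin, Thm. 1.6.1, proof (arXiv p. 12, L44–46)] -/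
theorem sub_mem_pow_of_compatible (red : ∀ k, E (k + 1) →ₗ[R] E k) (e : ℕ → ℕ)
    (hmono : Monotone e) {g : ∀ k, E k}
    (hg : ∀ k, ∀ r : R, r • g k = 0 ↔ r ∈ IsLocalRing.maximalIdeal R ^ e k)
    (hgc : ∀ k, red k (g (k + 1)) = g k) {y : ∀ k, E k} (hyc : ∀ k, red k (y (k + 1)) = y k)
    {c : ℕ → R} (hc : ∀ k, y k = c k • g k) {m n : ℕ} (hmn : m ≤ n) :
    c n - c m ∈ IsLocalRing.maximalIdeal R ^ e m := by
  induction n, hmn using Nat.le_induction with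
  | base => simp
  | succ n hmn ih =>
    have hstep : c (n + 1) - c n ∈ IsLocalRing.maximalIdeal R ^ e n := by
      refine (hg n _).mp ?_
      rw [sub_smul, ← hgc n, ← map_smul, ← hc (n + 1), hyc n, hc n, hgc n, sub_self]
    have h' : c (n + 1) - c m = (c (n + 1) - c n) + (c n - c m) := by ring
    rw [h']
    exact Ideal.add_mem _ (Ideal.pow_le_pow_right (hmono hmn) hstep) ih

/-- **Every compatible family is a multiple of the compatible system of generators** when `R` is
`𝔪`-adically precomplete (the coefficients converge). [cite: Howard2004HeegnerKolyvagin, Thm. 1.6.1, proof (arXiv p. 12, L44–46)] -/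
theorem exists_eq_smul_generators [IsPrecomplete (IsLocalRing.maximalIdeal R) R]
    (red : ∀ k, E (k + 1) →ₗ[R] E k) (e : ℕ → ℕ) (hmono : Monotone e) (hke : ∀ k, k ≤ e k)
    {g : ∀ k, E k} (hg : ∀ k, ∀ r : R, r • g k = 0 ↔ r ∈ IsLocalRing.maximalIdeal R ^ e k)
    (hgen : ∀ k, ∀ y : E k, ∃ r : R, y = r • g k) (hgc : ∀ k, red k (g (k + 1)) = g k)
    {y : ∀ k, E k} (hyc : ∀ k, red k (y (k + 1)) = y k) : ∃ r : R, y = r • g := by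
  choose c hc using fun k => hgen k (y k)
  have hU : ∀ n : ℕ, (IsLocalRing.maximalIdeal R ^ n • ⊤ : Submodule R R) =
      IsLocalRing.maximalIdeal R ^ n := fun n => by
    rw [Ideal.smul_eq_mul, Ideal.mul_top]
  have hcauchy : ∀ {m n : ℕ}, m ≤ n →
      c m ≡ c n [SMOD (IsLocalRing.maximalIdeal R ^ m • ⊤ : Submodule R R)] := by
    intro m n hmn
    rw [SModEq.sub_mem, hU]
    have h := sub_mem_pow_of_compatible red e hmono hg hgc hyc hc hmn
    have h' : c m - c n = -(c n - c m) := by ring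
    rw [h']
    exact neg_mem (Ideal.pow_le_pow_right (hke m) h)
  obtain ⟨L, hL⟩ := IsPrecomplete.prec ‹_› @hcauchy
  refine ⟨L, funext fun k => ?_⟩
  -- `c_k - L = (c_k - c_n) + (c_n - L)` with `n = max k (e k)`: both in `𝔪^{e_k}`
  set n := max k (e k) with hn
  have h1 : c n - c k ∈ IsLocalRing.maximalIdeal R ^ e k :=
    sub_mem_pow_of_compatible red e hmono hg hgc hyc hc (le_max_left k (e k))
  have h2 : c n - L ∈ IsLocalRing.maximalIdeal R ^ e k := by
    have h := hL n
    rw [SModEq.sub_mem, hU] at h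
    exact Ideal.pow_le_pow_right (le_max_right k (e k)) h
  have h3 : c k - L ∈ IsLocalRing.maximalIdeal R ^ e k := by
    have h' : c k - L = (c n - L) - (c n - c k) := by ring
    rw [h']
    exact Ideal.sub_mem _ h2 h1
  have h4 : (c k - L) • g k = 0 := (hg k _).mpr h3
  rw [Pi.smul_apply, hc k]
  rw [sub_smul] at h4
  exact (sub_eq_zero.mp h4)

/-- **«… is the `π`-adic Tate module of `H¹_F(K, A)`, and is therefore a free rank-one `R`-module»,
abstract form.**  Over an `𝔪`-adically complete local ring `R`, the compatible families of an inverse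
system of cyclic modules `E_k = R g_k`, `ann(g_k) = 𝔪^{e_k}` (`e` monotone, `k ≤ e_k`, `e_k ≥ 1`)
with surjective transitions are a free `R`-module of rank one: there is a compatible family `x` with
zero annihilator of which every compatible family is a multiple (the currency of
`AdicTower.IsFreeRankOneOn`), TOGETHER WITH the levelwise annihilators `ann(x_k) = 𝔪^{e_k}` (the
«injectivity of `H¹_F(K,T)/𝔪^k H¹_F(K,T) → H¹_F(K,T^{(k)})`» used for the length bound).
[cite: Howard2004HeegnerKolyvagin, Thm. 1.6.1, proof (arXiv p. 12, L44–46 and L50–55)] -/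
theorem exists_freeRankOne_generator_of_cyclic_tower' [IsAdicComplete (IsLocalRing.maximalIdeal R) R]
    (red : ∀ k, E (k + 1) →ₗ[R] E k) (hred : ∀ k, Function.Surjective (red k)) (e : ℕ → ℕ)
    (hmono : Monotone e) (hke : ∀ k, k ≤ e k) (he0 : ∀ k, 0 < e k)
    (hE : ∀ k, ∃ g : E k, (∀ r : R, r • g = 0 ↔ r ∈ IsLocalRing.maximalIdeal R ^ e k) ∧
      ∀ y : E k, ∃ r : R, y = r • g) :
    ∃ x : ∀ k, E k, (∀ k, red k (x (k + 1)) = x k) ∧ (∀ r : R, r • x = 0 → r = 0) ∧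
      (∀ y : ∀ k, E k, (∀ k, red k (y (k + 1)) = y k) → ∃ r : R, y = r • x) ∧
      ∀ k, ∀ r : R, r • x k = 0 ↔ r ∈ IsLocalRing.maximalIdeal R ^ e k := by
  obtain ⟨g, hg, hgen, hgc⟩ := exists_compatible_generators red hred e he0 hE
  refine ⟨g, hgc, fun r hr => ?_, fun y hyc => ?_, hg⟩
  · exact eq_zero_of_smul_generators_eq_zero e (fun n => ⟨n, hke n⟩) hg
      (fun k => by simpa using congr_fun hr k)
  · exact exists_eq_smul_generators red e hmono hke hg hgen hgc hyc

/-- `exists_freeRankOne_generator_of_cyclic_tower'` without the levelwise annihilators.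
[cite: Howard2004HeegnerKolyvagin, Thm. 1.6.1, proof (arXiv p. 12, L44–46)] -/
theorem exists_freeRankOne_generator_of_cyclic_tower [IsAdicComplete (IsLocalRing.maximalIdeal R) R]
    (red : ∀ k, E (k + 1) →ₗ[R] E k) (hred : ∀ k, Function.Surjective (red k)) (e : ℕ → ℕ)
    (hmono : Monotone e) (hke : ∀ k, k ≤ e k) (he0 : ∀ k, 0 < e k)
    (hE : ∀ k, ∃ g : E k, (∀ r : R, r • g = 0 ↔ r ∈ IsLocalRing.maximalIdeal R ^ e k) ∧
      ∀ y : E k, ∃ r : R, y = r • g) :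
    ∃ x : ∀ k, E k, (∀ k, red k (x (k + 1)) = x k) ∧ (∀ r : R, r • x = 0 → r = 0) ∧
      ∀ y : ∀ k, E k, (∀ k, red k (y (k + 1)) = y k) → ∃ r : R, y = r • x := by
  obtain ⟨x, h1, h2, h3, -⟩ :=
    exists_freeRankOne_generator_of_cyclic_tower' red hred e hmono hke he0 hE
  exact ⟨x, h1, h2, h3⟩

end TateModule

/-! ## §E. From §D to the tree's currency: `IsFreeRankOneOn (limitSelmer F)` from cyclic stable images (p. 12 L44–46) -/

section Bridge

namespace AdicTower

variable {K : Type} [Field K] [NumberField K] {R : Type} [CommRing R] [IsLocalRing R]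
  {N : ℕ → Type} [∀ k, AddCommGroup (N k)] [∀ k, TopologicalSpace (N k)]
  [∀ k, DiscreteTopology (N k)] [∀ k, Module R (N k)]

omit [NumberField K] in
/-- The reduction `H¹(K, T_{k+1}) → H¹(K, T_k)` commutes with the scalar actions `H¹(r•)` (it is `H¹`
of an `R`-linear equivariant map; tree `cohomologyMap_scalarMapH1`).
[cite: Howard2004HeegnerKolyvagin, §1.6 (arXiv p. 12, L29)] -/
theorem redH1_scalarMapH1 (T : AdicTower K R N) (k : ℕ) (r : R)
    (x : galoisCohomology (T.ρ (k + 1)) 1) :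
    T.redH1 k (galoisCohomology.scalarMapH1 (T.ρ (k + 1)) (T.hlin (k + 1)) r x) =
      galoisCohomology.scalarMapH1 (T.ρ k) (T.hlin k) r (T.redH1 k x) :=
  cohomologyMap_scalarMapH1 (T.hlin (k + 1)) (T.hlin k) (T.red k) (T.red_equivariant k) r x

omit [NumberField K] in
/-- `smulFamily r x` at level `k` is `H¹(r•) (x k)`. [cite: Howard2004HeegnerKolyvagin, §1.6 (arXiv p. 12, L29)] -/
theorem smulFamily_apply (T : AdicTower K R N) (r : R) (x : ∀ k, galoisCohomology (T.ρ k) 1) (k : ℕ) :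
    T.smulFamily r x k = galoisCohomology.scalarMapH1 (T.ρ k) (T.hlin k) r (x k) := rfl

/-- **«`H¹_F(K, T)` … is therefore a free rank-one `R`-module» in the tree's currency**, from CYCLIC
STABLE IMAGES: if `R` is an `𝔪`-adically complete local ring and there are `R`-stable subgroups
`E_k ≤ H¹_F(K, T_k)` containing the components of every compatible Selmer family, mapped ONTO each
other by the reductions, each cyclic with annihilator `𝔪^{e_k}` (`e` monotone, `k ≤ e_k`, `e_k ≥ 1`),
then `H¹_F(K, T) = lim_k H¹_F(K, T_k)` is free of rank one (`IsFreeRankOneOn`).  In the proof of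
Thm. 1.6.1 the `E_k` are the stable images `⋂_j red(H¹_F(K, T^{(j)}))`, cyclic by Lemma 1.3.3 and
Thm. 1.4.2 with `ε = 1` — an identification NOT made here (see the evidence note of item
stmt-BirchSwinnertonDyer-22642).  The primed form also returns `x_k ∈ E_k` and the levelwise
annihilators `ann(x_k) = 𝔪^{e_k}`.
[cite: Howard2004HeegnerKolyvagin, Thm. 1.6.1, proof (arXiv p. 12, L44–46 and L50–55)] -/
theorem exists_isFreeRankOneOn_of_cyclic_stableImages'
    [IsAdicComplete (IsLocalRing.maximalIdeal R) R]
    (T : AdicTower K R N) (F : ∀ k, SelmerStructure (T.ρ k)) (e : ℕ → ℕ)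
    (hmono : Monotone e) (hke : ∀ k, k ≤ e k) (he0 : ∀ k, 0 < e k)
    (E : ∀ k, AddSubgroup (galoisCohomology (T.ρ k) 1))
    (hEsel : ∀ k, E k ≤ (F k).selmerGroup)
    (hEsmul : ∀ k (r : R), ∀ y ∈ E k, galoisCohomology.scalarMapH1 (T.ρ k) (T.hlin k) r y ∈ E k)
    (hElim : ∀ x ∈ T.limitSelmer F, ∀ k, x k ∈ E k)
    (hEred : ∀ k, (E (k + 1)).map (T.redH1 k) = E k)
    (hEcyc : ∀ k, ∃ g ∈ E k,
      (∀ r : R, galoisCohomology.scalarMapH1 (T.ρ k) (T.hlin k) r g = 0 ↔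
        r ∈ IsLocalRing.maximalIdeal R ^ e k) ∧
      ∀ y ∈ E k, ∃ r : R, y = galoisCohomology.scalarMapH1 (T.ρ k) (T.hlin k) r g) :
    ∃ x : ∀ k, galoisCohomology (T.ρ k) 1, T.IsFreeRankOneOn (T.limitSelmer F) x ∧
      ∀ k, x k ∈ E k ∧ ∀ r : R, galoisCohomology.scalarMapH1 (T.ρ k) (T.hlin k) r (x k) = 0 ↔
        r ∈ IsLocalRing.maximalIdeal R ^ e k := by
  letI inst : ∀ k, Module R (galoisCohomology (T.ρ k) 1) :=
    fun k => galoisCohomology.moduleH1 (T.ρ k) (T.hlin k)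
  have hsmul : ∀ (k : ℕ) (r : R) (y : galoisCohomology (T.ρ k) 1),
      r • y = galoisCohomology.scalarMapH1 (T.ρ k) (T.hlin k) r y := fun k r y => rfl
  -- the `R`-submodules `E_k`
  let E' : ∀ k, Submodule R (galoisCohomology (T.ρ k) 1) := fun k =>
    { carrier := E k
      add_mem' := (E k).add_mem
      zero_mem' := (E k).zero_mem
      smul_mem' := fun r y hy => by
        change galoisCohomology.scalarMapH1 (T.ρ k) (T.hlin k) r y ∈ E k
        exact hEsmul k r y hy }
  have hmemE' : ∀ (k : ℕ) (y : galoisCohomology (T.ρ k) 1), y ∈ E' k ↔ y ∈ E k := fun k y => Iff.rfl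
  -- the reductions restricted to the `E_k`, as `R`-linear maps
  have hredmem : ∀ (k : ℕ) (y : galoisCohomology (T.ρ (k + 1)) 1), y ∈ E (k + 1) →
      T.redH1 k y ∈ E k := fun k y hy => by
    rw [← hEred k]
    exact AddSubgroup.mem_map_of_mem _ hy
  let red' : ∀ k, ↥(E' (k + 1)) →ₗ[R] ↥(E' k) := fun k =>
    { toFun := fun y => ⟨T.redH1 k y.1, hredmem k y.1 y.2⟩
      map_add' := fun y z => Subtype.ext (by simp)
      map_smul' := fun r y => Subtype.ext (by
        change T.redH1 k (galoisCohomology.scalarMapH1 _ _ r y.1) =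
          galoisCohomology.scalarMapH1 _ _ r (T.redH1 k y.1)
        exact T.redH1_scalarMapH1 k r y.1) }
  have hred'val : ∀ (k : ℕ) (y : ↥(E' (k + 1))), ((red' k y : ↥(E' k)) : galoisCohomology (T.ρ k) 1) =
      T.redH1 k y.1 := fun k y => rfl
  have hred'surj : ∀ k, Function.Surjective (red' k) := by
    intro k z
    have hz : (z : galoisCohomology (T.ρ k) 1) ∈ (E (k + 1)).map (T.redH1 k) := by
      rw [hEred k]; exact z.2
    obtain ⟨y, hy, hyz⟩ := AddSubgroup.mem_map.mp hz
    exact ⟨⟨y, hy⟩, Subtype.ext hyz⟩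
  have hE' : ∀ k, ∃ g : ↥(E' k), (∀ r : R, r • g = 0 ↔ r ∈ IsLocalRing.maximalIdeal R ^ e k) ∧
      ∀ y : ↥(E' k), ∃ r : R, y = r • g := by
    intro k
    obtain ⟨g, hg, hgann, hggen⟩ := hEcyc k
    refine ⟨⟨g, hg⟩, fun r => ?_, fun y => ?_⟩
    · rw [← hgann r, Subtype.ext_iff]
      exact Iff.rfl
    · obtain ⟨r, hr⟩ := hggen y.1 y.2
      exact ⟨r, Subtype.ext hr⟩
  obtain ⟨x', hx'c, hx'ann, hx'gen, hx'lev⟩ :=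
    exists_freeRankOne_generator_of_cyclic_tower' red' hred'surj e hmono hke he0 hE'
  refine ⟨fun k => (x' k).1, ⟨?_, fun r hr => ?_, fun y hy => ?_⟩, fun k => ⟨(x' k).2, fun r => ?_⟩⟩
  · -- `x ∈ lim_k H¹_F(K, T_k)`
    rw [AdicTower.mem_limitSelmer_iff]
    exact ⟨fun k => by rw [← hred'val]; exact congrArg Subtype.val (hx'c k),
      fun k => hEsel k (x' k).2⟩
  · -- zero annihilator
    refine hx'ann r (funext fun k => Subtype.ext ?_)
    have h := congr_fun hr k
    rw [smulFamily_apply] at h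
    simpa [hsmul] using h
  · -- generation
    have hyE : ∀ k, y k ∈ E k := hElim y hy
    obtain ⟨r, hr⟩ := hx'gen (fun k => ⟨y k, hyE k⟩) fun k => Subtype.ext (by
      rw [hred'val]
      exact ((T.mem_limitSelmer_iff F y).mp hy).1 k)
    refine ⟨r, funext fun k => ?_⟩
    have h := congrArg Subtype.val (congr_fun hr k)
    simpa [smulFamily_apply, hsmul] using h
  · -- levelwise annihilator
    rw [← hx'lev k r, Subtype.ext_iff, Submodule.coe_smul, hsmul]
    exact Iff.rfl

/-- `exists_isFreeRankOneOn_of_cyclic_stableImages'` without the levelwise data.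
[cite: Howard2004HeegnerKolyvagin, Thm. 1.6.1, proof (arXiv p. 12, L44–46)] -/
theorem exists_isFreeRankOneOn_of_cyclic_stableImages
    [IsAdicComplete (IsLocalRing.maximalIdeal R) R]
    (T : AdicTower K R N) (F : ∀ k, SelmerStructure (T.ρ k)) (e : ℕ → ℕ)
    (hmono : Monotone e) (hke : ∀ k, k ≤ e k) (he0 : ∀ k, 0 < e k)
    (E : ∀ k, AddSubgroup (galoisCohomology (T.ρ k) 1))
    (hEsel : ∀ k, E k ≤ (F k).selmerGroup)
    (hEsmul : ∀ k (r : R), ∀ y ∈ E k, galoisCohomology.scalarMapH1 (T.ρ k) (T.hlin k) r y ∈ E k)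
    (hElim : ∀ x ∈ T.limitSelmer F, ∀ k, x k ∈ E k)
    (hEred : ∀ k, (E (k + 1)).map (T.redH1 k) = E k)
    (hEcyc : ∀ k, ∃ g ∈ E k,
      (∀ r : R, galoisCohomology.scalarMapH1 (T.ρ k) (T.hlin k) r g = 0 ↔
        r ∈ IsLocalRing.maximalIdeal R ^ e k) ∧
      ∀ y ∈ E k, ∃ r : R, y = galoisCohomology.scalarMapH1 (T.ρ k) (T.hlin k) r g) :
    ∃ x : ∀ k, galoisCohomology (T.ρ k) 1, T.IsFreeRankOneOn (T.limitSelmer F) x := by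
  obtain ⟨x, hx, -⟩ := T.exists_isFreeRankOneOn_of_cyclic_stableImages' F e hmono hke he0 E hEsel hEsmul
    hElim hEred hEcyc
  exact ⟨x, hx⟩

end AdicTower

end Bridge

/-! ## §F. The cyclic stable images `red^{(j→k)}(H¹_F(K, T^{(j)}))`, abstract form (p. 12 L36–46)

Pure commutative algebra feeding §E: nothing here identifies the abstract data with the tree's objects
(that identification is Lemma 1.3.3 + Thm. 1.4.2 + `ε = 1`, the needs-X of the evidence note). -/

section StableImages

variable {R : Type*} [CommRing R] [IsDomain R] [IsLocalRing R] {π : R}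

omit [IsDomain R] in
/-- `r ∈ 𝔪^n ↔ π^n ∣ r` for `𝔪 = (π)`. [folklore] -/
private theorem mem_maximalIdeal_pow_iff_dvd (hunif : IsLocalRing.maximalIdeal R = Ideal.span {π})
    {n : ℕ} {r : R} : r ∈ IsLocalRing.maximalIdeal R ^ n ↔ π ^ n ∣ r := by
  rw [hunif, Ideal.span_singleton_pow, Ideal.mem_span_singleton]

/-- `r π^m ∈ 𝔪^e ↔ r ∈ 𝔪^{e-m}` (`m ≤ e`, `π ≠ 0`, `𝔪 = (π)`). [folklore] -/
private theorem mul_pow_mem_pow_iff (hπ0 : π ≠ 0)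
    (hunif : IsLocalRing.maximalIdeal R = Ideal.span {π}) {e m : ℕ} (hme : m ≤ e) (r : R) :
    r * π ^ m ∈ IsLocalRing.maximalIdeal R ^ e ↔ r ∈ IsLocalRing.maximalIdeal R ^ (e - m) := by
  rw [mem_maximalIdeal_pow_iff_dvd hunif, mem_maximalIdeal_pow_iff_dvd hunif]
  have h : π ^ e = π ^ (e - m) * π ^ m := by rw [← pow_add, Nat.sub_add_cancel hme]
  rw [h]
  exact mul_dvd_mul_iff_right (pow_ne_zero m hπ0)

omit [IsDomain R] [IsLocalRing R] in
/-- The `R`-action on the quotient ring: `r • [x] = [r x]`. [folklore] -/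
private theorem smul_mk_eq (I : Ideal R) (r x : R) :
    r • Ideal.Quotient.mk I x = Ideal.Quotient.mk I (r * x) := by
  rw [← smul_eq_mul, ← Ideal.Quotient.mk_eq_mk, ← Submodule.Quotient.mk_smul]; rfl

variable {A B : Type*} [AddCommGroup A] [Module R A] [AddCommGroup B] [Module R B]
  {M : Type*} [AddCommGroup M] [Module R M]

/-- L1: a submodule `N ≤ A` transported by an injection `φ` onto `π^m · B`, `B ≅ R/𝔪^e ⊕ M ⊕ M` with
`π^c M = 0`, `c ≤ m ≤ e`, is cyclic with a generator of annihilator `𝔪^{e-m}` — the computation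
«`𝔪^{m}(R/𝔪^e ⊕ M ⊕ M) = 𝔪^m R/𝔪^e ≅ R/𝔪^{e-m}`» behind «`H¹_F(K,A)[𝔪^k] ≅ R/𝔪^k ⊕ M^{(k)} ⊕ M^{(k)}` …
the `π`-adic Tate module». [folklore] -/
private theorem cyclic_of_transport (hπ0 : π ≠ 0)
    (hunif : IsLocalRing.maximalIdeal R = Ideal.span {π}) (N : Submodule R A) (φ : A →ₗ[R] B)
    (hφ : Function.Injective φ) {e m c : ℕ} (hcm : c ≤ m) (hme : m ≤ e)
    (hM : ∀ x : M, π ^ c • x = 0) (θ : B ≃ₗ[R] (R ⧸ IsLocalRing.maximalIdeal R ^ e) × (M × M))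
    (h1 : ∀ x ∈ N, ∃ y : B, φ x = π ^ m • y) (h2 : ∀ y : B, ∃ x ∈ N, φ x = π ^ m • y) :
    ∃ g ∈ N, (∀ r : R, r • g = 0 ↔ r ∈ IsLocalRing.maximalIdeal R ^ (e - m)) ∧
      ∀ y ∈ N, ∃ r : R, y = r • g := by
  have hMm : ∀ x : M, π ^ m • x = 0 := fun x => by
    rw [← Nat.sub_add_cancel hcm, pow_add, mul_smul, hM, smul_zero]
  set b0 : B := θ.symm (1, 0) with hb0
  obtain ⟨g, hgN, hg⟩ := h2 b0
  have hθb0 : θ b0 = (1, 0) := by rw [hb0, LinearEquiv.apply_symm_apply]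
  refine ⟨g, hgN, fun r => ?_, fun y hy => ?_⟩
  · rw [← map_eq_zero_iff φ hφ, map_smul, hg, smul_smul, ← map_eq_zero_iff θ θ.injective,
      map_smul, hθb0, Prod.smul_mk, smul_zero, Prod.mk_eq_zero, and_iff_left rfl,
      ← map_one (Ideal.Quotient.mk (IsLocalRing.maximalIdeal R ^ e)), smul_mk_eq, mul_one,
      Ideal.Quotient.eq_zero_iff_mem]
    exact mul_pow_mem_pow_iff hπ0 hunif hme r
  · obtain ⟨b, hb⟩ := h1 y hy
    obtain ⟨a, ha⟩ := Ideal.Quotient.mk_surjective (θ b).1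
    refine ⟨a, hφ ?_⟩
    rw [hb, map_smul, hg, smul_smul, ← θ.injective.eq_iff, map_smul, map_smul, hθb0]
    refine Prod.ext ?_ ?_
    · rw [Prod.smul_fst, Prod.smul_fst, ← ha, smul_mk_eq,
        ← map_one (Ideal.Quotient.mk (IsLocalRing.maximalIdeal R ^ e)), smul_mk_eq, mul_one, mul_comm]
    · rw [Prod.smul_snd, Prod.smul_snd, smul_zero]
      exact Prod.ext (by simp [hMm]) (by simp [hMm])

/-- L2: `A' ≤ B'` submodules over a local domain with `𝔪 = (π)`, `A'` containing an element of
annihilator EXACTLY `𝔪^e`, `B'` generated by an element of annihilator `𝔪^e`: then `B' ≤ A'` (a cyclic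
module `R/𝔪^e` has no proper submodule with the same annihilator). [folklore] -/
private theorem le_of_cyclic_same_annihilator (hπ0 : π ≠ 0) (hπu : ¬ IsUnit π)
    (hunif : IsLocalRing.maximalIdeal R = Ideal.span {π}) {A' B' : Submodule R A} (hAB : A' ≤ B')
    {e : ℕ} {a b : A} (ha : a ∈ A') (haann : ∀ r : R, r • a = 0 ↔ r ∈ IsLocalRing.maximalIdeal R ^ e)
    (hbann : ∀ r : R, r • b = 0 ↔ r ∈ IsLocalRing.maximalIdeal R ^ e)
    (hbgen : ∀ y ∈ B', ∃ r : R, y = r • b) : B' ≤ A' := by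
  rcases Nat.eq_zero_or_pos e with he | he
  · -- `e = 0`: `b = 0`, so `B' = 0`
    subst he
    have hb : b = 0 := by
      have h := (hbann 1).mpr (by simp)
      rwa [one_smul] at h
    intro y hy
    obtain ⟨r, rfl⟩ := hbgen y hy
    rw [hb, smul_zero]
    exact A'.zero_mem
  obtain ⟨r, hr⟩ := hbgen a (hAB ha)
  -- `r` is a unit: otherwise `r = π s` and `π^{e-1}` kills `a`
  have hru : IsUnit r := by
    by_contra hru
    have hrm : r ∈ IsLocalRing.maximalIdeal R := (IsLocalRing.mem_maximalIdeal r).mpr hru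
    rw [hunif, Ideal.mem_span_singleton] at hrm
    obtain ⟨s, rfl⟩ := hrm
    have hkill : π ^ (e - 1) • a = 0 := by
      rw [hr, smul_smul, show π ^ (e - 1) * (π * s) = s * π ^ e by
        rw [← mul_assoc, ← pow_succ, Nat.sub_add_cancel he, mul_comm], mul_smul,
        (hbann _).mpr (by rw [hunif, Ideal.span_singleton_pow]; exact Ideal.mem_span_singleton_self _),
        smul_zero]
    have hmem : π ^ (e - 1) ∈ IsLocalRing.maximalIdeal R ^ e := (haann _).mp hkill
    rw [hunif, Ideal.span_singleton_pow, Ideal.mem_span_singleton, pow_dvd_pow_iff hπ0 hπu] at hmem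
    omega
  obtain ⟨u, rfl⟩ := hru
  have hb : b = ((u⁻¹ : Rˣ) : R) • a := by rw [hr, smul_smul, Units.inv_mul, one_smul]
  intro y hy
  obtain ⟨t, rfl⟩ := hbgen y hy
  rw [hb, smul_smul]
  exact A'.smul_mem _ ha

variable {S : ℕ → Type*} [∀ k, AddCommGroup (S k)] [∀ k, Module R (S k)]
  {M' : ℕ → Type*} [∀ k, AddCommGroup (M' k)] [∀ k, Module R (M' k)]

/-- `e k + d ≤ e (k + d)` for a strictly increasing `e : ℕ → ℕ`. [folklore] -/
private theorem strictMono_add_le {e : ℕ → ℕ} (he : StrictMono e) (k d : ℕ) : e k + d ≤ e (k + d) := by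
  induction d with
  | zero => simp
  | succ d ih =>
    have h1 : e (k + d) < e (k + d + 1) := he (by omega)
    show e k + (d + 1) ≤ e (k + d + 1)
    omega

/-- **The cyclic stable images, abstract form** (the levels of the `π`-adic Tate module of the
`𝒟`-summand of «`H¹_F(K, A) ≅ 𝒟 ⊕ M ⊕ M`»): levels `S_k ≅ R/𝔪^{e_k} ⊕ M_k ⊕ M_k` (Thm. 1.4.2 with
`ε = 1`; `M_k` killed by a fixed `π^c`), injections `inc_k : S_k ↪ S_{k+1}` (Lemma 1.3.3) and
reductions with `inc_k ∘ red_k = π^{e_{k+1}-e_k}` (the tower identity `inc_red`), `e` strictly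
increasing, `𝔪 = (π)`: then the images `E_k := red^{(k+c→k)}(S_{k+c})` satisfy `red(E_{k+1}) = E_k`,
are cyclic with a generator of annihilator `𝔪^{e_k}`, and contain the components of every compatible
family — the hypotheses of `AdicTower.exists_isFreeRankOneOn_of_cyclic_stableImages` (§E).
[cite: Howard2004HeegnerKolyvagin, Thm. 1.6.1, proof (arXiv p. 12, L36–46)] -/
theorem exists_cyclic_stableImages (hπ0 : π ≠ 0) (hπu : ¬ IsUnit π)
    (hunif : IsLocalRing.maximalIdeal R = Ideal.span {π})
    (red : ∀ k, S (k + 1) →ₗ[R] S k) (inc : ∀ k, S k →ₗ[R] S (k + 1))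
    (hinc : ∀ k, Function.Injective (inc k)) (e : ℕ → ℕ) (he : StrictMono e)
    (hincred : ∀ k (y : S (k + 1)), inc k (red k y) = π ^ (e (k + 1) - e k) • y)
    (c : ℕ) (hM : ∀ k (x : M' k), π ^ c • x = 0)
    (θ : ∀ k, S k ≃ₗ[R] (R ⧸ IsLocalRing.maximalIdeal R ^ e k) × (M' k × M' k)) :
    ∃ E : ∀ k, Submodule R (S k),
      (∀ k, (E (k + 1)).map (red k) = E k) ∧
      (∀ k, ∃ g ∈ E k, (∀ r : R, r • g = 0 ↔ r ∈ IsLocalRing.maximalIdeal R ^ e k) ∧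
        ∀ y ∈ E k, ∃ r : R, y = r • g) ∧
      (∀ x : ∀ k, S k, (∀ k, red k (x (k + 1)) = x k) → ∀ k, x k ∈ E k) := by
  -- the images `I d k = red^{(k+d → k)}(S_{k+d})`
  let I : ℕ → ∀ k, Submodule R (S k) := fun d =>
    Nat.rec (motive := fun _ => ∀ k, Submodule R (S k)) (fun _ => ⊤)
      (fun _ Id k => (Id (k + 1)).map (red k)) d
  have I_zero : ∀ k, I 0 k = ⊤ := fun k => rfl
  have I_succ : ∀ d k, I (d + 1) k = (I d (k + 1)).map (red k) := fun d k => rfl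
  have I_anti : ∀ d k, I (d + 1) k ≤ I d k := by
    intro d
    induction d with
    | zero => intro k; rw [I_zero]; exact le_top
    | succ d ih => intro k; rw [I_succ (d + 1) k, I_succ d k]; exact Submodule.map_mono (ih (k + 1))
  have I_mem : ∀ x : ∀ k, S k, (∀ k, red k (x (k + 1)) = x k) → ∀ d k, x k ∈ I d k := by
    intro x hx d
    induction d with
    | zero => intro k; rw [I_zero]; trivial
    | succ d ih => intro k; rw [I_succ, ← hx k]; exact Submodule.mem_map_of_mem (ih (k + 1))
  -- transport: `I d k ≅ π^{e_j - e_k} S_j` along an injection, `j = k + d`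
  have I_transport : ∀ (d k j : ℕ), k + d = j → ∃ φ : S k →ₗ[R] S j, Function.Injective φ ∧
      (∀ x ∈ I d k, ∃ y : S j, φ x = π ^ (e j - e k) • y) ∧
      (∀ y : S j, ∃ x ∈ I d k, φ x = π ^ (e j - e k) • y) := by
    intro d
    induction d with
    | zero =>
      intro k j hkj
      obtain rfl : k = j := by simpa using hkj
      exact ⟨LinearMap.id, Function.injective_id, fun x _ => ⟨x, by simp⟩,
        fun y => ⟨y, by rw [I_zero]; trivial, by simp⟩⟩
    | succ d ih =>
      intro k j hkj
      obtain ⟨φ, hφinj, hφ1, hφ2⟩ := ih (k + 1) j (by omega)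
      have hlt : e k < e (k + 1) := he (Nat.lt_succ_self k)
      have hle : e (k + 1) ≤ e j := he.monotone (by omega)
      have hexp : e (k + 1) - e k + (e j - e (k + 1)) = e j - e k := by omega
      refine ⟨φ ∘ₗ inc k, hφinj.comp (hinc k), fun x hx => ?_, fun y => ?_⟩
      · rw [I_succ] at hx
        obtain ⟨w, hw, rfl⟩ := Submodule.mem_map.mp hx
        obtain ⟨y, hy⟩ := hφ1 w hw
        refine ⟨y, ?_⟩
        rw [LinearMap.comp_apply, hincred, map_smul, hy, smul_smul, ← pow_add, hexp]
      · obtain ⟨w, hw, hφw⟩ := hφ2 y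
        refine ⟨red k w, by rw [I_succ]; exact Submodule.mem_map_of_mem hw, ?_⟩
        rw [LinearMap.comp_apply, hincred, map_smul, hφw, smul_smul, ← pow_add, hexp]
  -- the images `I d k` for `d ≥ c` are cyclic with annihilator `𝔪^{e_k}`
  have I_cyclic : ∀ d k, c ≤ d → ∃ g ∈ I d k,
      (∀ r : R, r • g = 0 ↔ r ∈ IsLocalRing.maximalIdeal R ^ e k) ∧
        ∀ y ∈ I d k, ∃ r : R, y = r • g := by
    intro d k hcd
    obtain ⟨φ, hφinj, hφ1, hφ2⟩ := I_transport d k (k + d) rfl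
    have hm : c ≤ e (k + d) - e k := by have := strictMono_add_le he k d; omega
    have hme : e (k + d) - e k ≤ e (k + d) := Nat.sub_le _ _
    have hek : e (k + d) - (e (k + d) - e k) = e k := by
      have := he.monotone (Nat.le_add_right k d); omega
    obtain ⟨g, hg, hgann, hggen⟩ :=
      cyclic_of_transport hπ0 hunif (I d k) φ hφinj hm hme (hM (k + d)) (θ (k + d)) hφ1 hφ2
    exact ⟨g, hg, fun r => by rw [hgann, hek], hggen⟩
  refine ⟨fun k => I c k, fun k => ?_, fun k => I_cyclic c k le_rfl, fun x hx k => I_mem x hx c k⟩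
  -- `red (E_{k+1}) = I (c+1) k = I c k`
  rw [← I_succ]
  refine le_antisymm (I_anti c k) ?_
  obtain ⟨a, ha, haann, -⟩ := I_cyclic (c + 1) k (Nat.le_succ c)
  obtain ⟨b, -, hbann, hbgen⟩ := I_cyclic c k le_rfl
  exact le_of_cyclic_same_annihilator hπ0 hπu hunif (I_anti c k) ha haann hbann hbgen

end StableImages

/-! ## §G. Conclusion (i) of Thm. 1.6.1 in the tree's currency MODULO Lemma 1.3.3 and Thm. 1.4.2 (with `ε = 1`):
`H¹_F(K, T)` is free of rank one (p. 12 L36–46) -/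

section ConclusionOne

namespace AdicTower

variable {K : Type} [Field K] [NumberField K] {R : Type} [CommRing R] [IsDomain R] [IsLocalRing R]
  {N : ℕ → Type} [∀ k, AddCommGroup (N k)] [∀ k, TopologicalSpace (N k)]
  [∀ k, DiscreteTopology (N k)] [∀ k, Module R (N k)]

section IncLemmas

variable (T : AdicTower K R N) (π : R) (e : ℕ → ℕ)
  (hkill : ∀ k, ∀ r ∈ IsLocalRing.maximalIdeal R ^ e k, ∀ x : N k, r • x = 0)
  (hker : ∀ k, LinearMap.ker (T.red k) =
    (IsLocalRing.maximalIdeal R ^ e k) • (⊤ : Submodule R (N (k + 1))))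
  (hπ : π ∈ IsLocalRing.maximalIdeal R) (he : ∀ k, e k ≤ e (k + 1))

-- `AdicTower.incH1_scalarMapH1` (the transitions commute with the scalars) is the tree's
-- `SelmerAScalarStabilityProofs` (x10b-p1-w2), imported above.

omit [NumberField K] [IsDomain R] in
/-- **`H¹(inc) ∘ H¹(red) = H¹(π^{e_{k+1}-e_k} •)`** on `H¹(K, T_{k+1})`: the cohomology of the tower
identity `inc ∘ red = π^{e_{k+1}-e_k}` (`inc_red`) — the reduction `T^{(k+1)} ↠ T^{(k)}` read inside
`A` is multiplication by `π^{e_{k+1}-e_k}` on `A[𝔪^{e_{k+1}}]`.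
[cite: Howard2004HeegnerKolyvagin, §1.6 (arXiv p. 12, L40–48)] -/
theorem incH1_redH1 (k : ℕ) (x : galoisCohomology (T.ρ (k + 1)) 1) :
    T.incH1 π e hkill hker hπ he k (T.redH1 k x) =
      galoisCohomology.scalarMapH1 (T.ρ (k + 1)) (T.hlin (k + 1)) (π ^ (e (k + 1) - e k)) x := by
  have hsq := cohomologyMap_one_comm_sq (T.ρ (k + 1)) (T.ρ k) (T.ρ (k + 1)) (T.ρ (k + 1))
    (T.red k).toAddMonoidHom (T.red_equivariant k)
    (inc T π e hkill hker hπ he k).toAddMonoidHom (inc_equivariant T π e hkill hker hπ he k)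
    (AddMonoidHom.id (N (k + 1))) (fun _ _ => rfl)
    (DistribSMul.toAddMonoidHom (N (k + 1)) (π ^ (e (k + 1) - e k)))
    (fun g y => ((T.hlin (k + 1)) g (π ^ (e (k + 1) - e k)) y).symm)
    (fun y => inc_red T π e hkill hker hπ he k y) x
  rw [cohomologyMap_id_apply,
    _root_.Literature.NumberTheory.GaloisCohomology.Howard2004.cohomologyMap_smul_eq_scalarMapH1] at hsq
  exact hsq

end IncLemmas

/-- **Thm. 1.6.1, conclusion (i) «`H¹_F(K, T)` is a free rank-one `R`-module», MODULO the printed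
inputs Lemma 1.3.3 and Thm. 1.4.2 (with `ε = 1`)**, on the tree's objects.  Hypotheses, beyond the
π-adic tower of an `𝔪`-adically complete local domain `R` with `𝔪 = (π)` and strictly increasing
exponents `e` (`e_0 ≥ 1`): the level Selmer groups `H¹_F(K, T_k)` are `R`-stable and the reductions map
them to each other (Howard: `F` on `T^{(k)}` is propagated from `T`); the transitions `H¹(inc)` map
`H¹_F(K, T_k)` INJECTIVELY into `H¹_F(K, T_{k+1})` (Lemma 1.3.3, the part used); and additive
`R`-equivariant structure isomorphisms `H¹_F(K, T_k) ≅ R/𝔪^{e_k} ⊕ M_k ⊕ M_k` with the `M_k` killed by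
a fixed `π^c` (Thm. 1.4.2 + Prop. 1.5.5 with `ε = 1`, as forced by Lemma 1.6.4 and §B; `c` from
`λ^{(k)} < e_k`).  Conclusion: `∃ x, IsFreeRankOneOn (limitSelmer F) x`.  Proof: §F (cyclic stable
images) + §E (Tate-module freeness).  This does NOT prove `thm161_dvrKolyvaginBound` (conclusions
(ii), (iii) and the three printed inputs remain).  The primed form also returns the levelwise
annihilators `ann(x_k) = 𝔪^{e_k}` (needed for (iii)).
[cite: Howard2004HeegnerKolyvagin, Thm. 1.6.1, proof (arXiv p. 12, L36–46 and L50–55)] -/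
theorem exists_isFreeRankOneOn_of_levelwise' [IsAdicComplete (IsLocalRing.maximalIdeal R) R]
    (T : AdicTower K R N) (F : ∀ k, SelmerStructure (T.ρ k)) {π : R} (hπ0 : π ≠ 0)
    (hπu : ¬ IsUnit π) (hunif : IsLocalRing.maximalIdeal R = Ideal.span {π}) (e : ℕ → ℕ)
    (he : StrictMono e) (he0 : 0 < e 0)
    (hkill : ∀ k, ∀ r ∈ IsLocalRing.maximalIdeal R ^ e k, ∀ x : N k, r • x = 0)
    (hker : ∀ k, LinearMap.ker (T.red k) =
      (IsLocalRing.maximalIdeal R ^ e k) • (⊤ : Submodule R (N (k + 1))))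
    (hπ : π ∈ IsLocalRing.maximalIdeal R) (hle : ∀ k, e k ≤ e (k + 1))
    (hFsmul : ∀ k (r : R), ∀ y ∈ (F k).selmerGroup,
      galoisCohomology.scalarMapH1 (T.ρ k) (T.hlin k) r y ∈ (F k).selmerGroup)
    (hFred : ∀ k, ∀ y ∈ (F (k + 1)).selmerGroup, T.redH1 k y ∈ (F k).selmerGroup)
    (hFinc : ∀ k, ∀ y ∈ (F k).selmerGroup, T.incH1 π e hkill hker hπ hle k y ∈ (F (k + 1)).selmerGroup)
    (hFinj : ∀ k, ∀ y ∈ (F k).selmerGroup, T.incH1 π e hkill hker hπ hle k y = 0 → y = 0)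
    {M : ℕ → Type} [∀ k, AddCommGroup (M k)] [∀ k, Module R (M k)] (c : ℕ)
    (hM : ∀ k (m : M k), π ^ c • m = 0)
    (θ : ∀ k, ↥((F k).selmerGroup) ≃+ (R ⧸ IsLocalRing.maximalIdeal R ^ e k) × (M k × M k))
    (hθ : ∀ k (r : R) (y : galoisCohomology (T.ρ k) 1) (hy : y ∈ (F k).selmerGroup),
      θ k ⟨galoisCohomology.scalarMapH1 (T.ρ k) (T.hlin k) r y, hFsmul k r y hy⟩ = r • θ k ⟨y, hy⟩) :
    ∃ x : ∀ k, galoisCohomology (T.ρ k) 1, T.IsFreeRankOneOn (T.limitSelmer F) x ∧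
      ∀ k, ∀ r : R, galoisCohomology.scalarMapH1 (T.ρ k) (T.hlin k) r (x k) = 0 ↔
        r ∈ IsLocalRing.maximalIdeal R ^ e k := by
  letI inst : ∀ k, Module R (galoisCohomology (T.ρ k) 1) :=
    fun k => galoisCohomology.moduleH1 (T.ρ k) (T.hlin k)
  have hsmul : ∀ (k : ℕ) (r : R) (y : galoisCohomology (T.ρ k) 1),
      r • y = galoisCohomology.scalarMapH1 (T.ρ k) (T.hlin k) r y := fun k r y => rfl
  -- the Selmer submodules
  let Sel : ∀ k, Submodule R (galoisCohomology (T.ρ k) 1) := fun k =>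
    { carrier := (F k).selmerGroup
      add_mem' := ((F k).selmerGroup).add_mem
      zero_mem' := ((F k).selmerGroup).zero_mem
      smul_mem' := fun r y hy => by
        change galoisCohomology.scalarMapH1 (T.ρ k) (T.hlin k) r y ∈ (F k).selmerGroup
        exact hFsmul k r y hy }
  have hmemSel : ∀ (k : ℕ) (y : galoisCohomology (T.ρ k) 1), y ∈ Sel k ↔ y ∈ (F k).selmerGroup :=
    fun k y => Iff.rfl
  -- restricted reductions and transitions
  let red' : ∀ k, ↥(Sel (k + 1)) →ₗ[R] ↥(Sel k) := fun k =>
    { toFun := fun y => ⟨T.redH1 k y.1, hFred k y.1 y.2⟩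
      map_add' := fun y z => Subtype.ext (by simp)
      map_smul' := fun r y => Subtype.ext (by
        change T.redH1 k (galoisCohomology.scalarMapH1 _ _ r y.1) =
          galoisCohomology.scalarMapH1 _ _ r (T.redH1 k y.1)
        exact T.redH1_scalarMapH1 k r y.1) }
  have hred'val : ∀ (k : ℕ) (y : ↥(Sel (k + 1))),
      ((red' k y : ↥(Sel k)) : galoisCohomology (T.ρ k) 1) = T.redH1 k y.1 := fun k y => rfl
  let inc' : ∀ k, ↥(Sel k) →ₗ[R] ↥(Sel (k + 1)) := fun k =>
    { toFun := fun y => ⟨T.incH1 π e hkill hker hπ hle k y.1, hFinc k y.1 y.2⟩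
      map_add' := fun y z => Subtype.ext (by simp)
      map_smul' := fun r y => Subtype.ext (by
        change T.incH1 π e hkill hker hπ hle k (galoisCohomology.scalarMapH1 _ _ r y.1) =
          galoisCohomology.scalarMapH1 _ _ r (T.incH1 π e hkill hker hπ hle k y.1)
        exact T.incH1_scalarMapH1 π e hkill hker hπ hle k r y.1) }
  have hinc'val : ∀ (k : ℕ) (y : ↥(Sel k)),
      ((inc' k y : ↥(Sel (k + 1))) : galoisCohomology (T.ρ (k + 1)) 1) =
        T.incH1 π e hkill hker hπ hle k y.1 := fun k y => rfl
  have hinc'inj : ∀ k, Function.Injective (inc' k) := by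
    intro k y z hyz
    have h : inc' k (y - z) = 0 := by rw [map_sub, hyz, sub_self]
    have h' : (y - z : ↥(Sel k)) = 0 :=
      Subtype.ext (hFinj k _ (y - z).2 (congrArg Subtype.val h))
    exact sub_eq_zero.mp h'
  have hincred' : ∀ (k : ℕ) (y : ↥(Sel (k + 1))), inc' k (red' k y) = π ^ (e (k + 1) - e k) • y := by
    intro k y
    refine Subtype.ext ?_
    rw [hinc'val, hred'val, Submodule.coe_smul, hsmul]
    exact T.incH1_redH1 π e hkill hker hπ hle k y.1
  -- the structure isomorphisms as `R`-linear equivalences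
  let θ' : ∀ k, ↥(Sel k) ≃ₗ[R] (R ⧸ IsLocalRing.maximalIdeal R ^ e k) × (M k × M k) := fun k =>
    { toFun := fun y => θ k ⟨y.1, y.2⟩
      invFun := fun z => ⟨((θ k).symm z).1, ((θ k).symm z).2⟩
      map_add' := fun y z => by
        rw [← map_add]; rfl
      map_smul' := fun r y => by
        rw [RingHom.id_apply, ← hθ k r y.1 y.2]; rfl
      left_inv := fun y => Subtype.ext (by simp)
      right_inv := fun z => by simp }
  obtain ⟨E', hE'red, hE'cyc, hE'mem⟩ :=
    exists_cyclic_stableImages hπ0 hπu hunif red' inc' hinc'inj e he hincred' c hM θ'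
  -- push the `E'_k ≤ Sel_k` into `H¹(K, T_k)` and apply §E
  let E : ∀ k, AddSubgroup (galoisCohomology (T.ρ k) 1) := fun k =>
    ((E' k).map (Sel k).subtype).toAddSubgroup
  have hmemE : ∀ (k : ℕ) (y : galoisCohomology (T.ρ k) 1),
      y ∈ E k ↔ ∃ z ∈ E' k, (z : galoisCohomology (T.ρ k) 1) = y := fun k y => by
    change y ∈ (E' k).map (Sel k).subtype ↔ _
    rw [Submodule.mem_map]
    rfl
  have hmono : Monotone e := he.monotone
  have hke : ∀ k, k ≤ e k := fun k => he.id_le k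
  have he0' : ∀ k, 0 < e k := fun k => lt_of_lt_of_le he0 (hmono (Nat.zero_le k))
  have hEsel : ∀ k, E k ≤ (F k).selmerGroup := fun k y hy => by
    obtain ⟨z, -, rfl⟩ := (hmemE k y).mp hy
    exact z.2
  have hEsmul : ∀ k (r : R), ∀ y ∈ E k,
      galoisCohomology.scalarMapH1 (T.ρ k) (T.hlin k) r y ∈ E k := fun k r y hy => by
    obtain ⟨z, hz, rfl⟩ := (hmemE k y).mp hy
    exact (hmemE k _).mpr ⟨r • z, (E' k).smul_mem r hz, by rw [Submodule.coe_smul, hsmul]⟩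
  have hElim : ∀ x ∈ T.limitSelmer F, ∀ k, x k ∈ E k := fun x hx k => by
    have hxc := ((T.mem_limitSelmer_iff F x).mp hx)
    let x' : ∀ k, ↥(Sel k) := fun k => ⟨x k, hxc.2 k⟩
    have hx'c : ∀ k, red' k (x' (k + 1)) = x' k := fun k => Subtype.ext (hxc.1 k)
    exact (hmemE k _).mpr ⟨x' k, hE'mem x' hx'c k, rfl⟩
  have hEred : ∀ k, (E (k + 1)).map (T.redH1 k) = E k := fun k => by
    ext y
    constructor
    · rintro ⟨w, hw, rfl⟩
      obtain ⟨z, hz, rfl⟩ := (hmemE (k + 1) w).mp hw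
      refine (hmemE k _).mpr ⟨red' k z, ?_, rfl⟩
      rw [← hE'red k]
      exact Submodule.mem_map_of_mem hz
    · intro hy
      obtain ⟨w, hw, rfl⟩ := (hmemE k y).mp hy
      rw [← hE'red k] at hw
      obtain ⟨z, hz, rfl⟩ := Submodule.mem_map.mp hw
      exact ⟨z.1, (hmemE (k + 1) _).mpr ⟨z, hz, rfl⟩, rfl⟩
  have hEcyc : ∀ k, ∃ g ∈ E k,
      (∀ r : R, galoisCohomology.scalarMapH1 (T.ρ k) (T.hlin k) r g = 0 ↔
        r ∈ IsLocalRing.maximalIdeal R ^ e k) ∧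
      ∀ y ∈ E k, ∃ r : R, y = galoisCohomology.scalarMapH1 (T.ρ k) (T.hlin k) r g := fun k => by
    obtain ⟨g, hg, hgann, hggen⟩ := hE'cyc k
    refine ⟨g.1, (hmemE k _).mpr ⟨g, hg, rfl⟩, fun r => ?_, fun y hy => ?_⟩
    · rw [← hgann r, ← hsmul, ← Submodule.coe_smul]
      exact ⟨fun h => Subtype.ext h, fun h => congrArg Subtype.val h⟩
    · obtain ⟨z, hz, rfl⟩ := (hmemE k y).mp hy
      obtain ⟨r, hr⟩ := hggen z hz
      exact ⟨r, by rw [hr, Submodule.coe_smul, hsmul]⟩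
  obtain ⟨x, hx, hxlev⟩ := T.exists_isFreeRankOneOn_of_cyclic_stableImages' F e hmono hke he0' E
    hEsel hEsmul hElim hEred hEcyc
  exact ⟨x, hx, fun k => (hxlev k).2⟩

/-- `exists_isFreeRankOneOn_of_levelwise'` without the levelwise annihilators.
[cite: Howard2004HeegnerKolyvagin, Thm. 1.6.1, proof (arXiv p. 12, L36–46)] -/
theorem exists_isFreeRankOneOn_of_levelwise [IsAdicComplete (IsLocalRing.maximalIdeal R) R]
    (T : AdicTower K R N) (F : ∀ k, SelmerStructure (T.ρ k)) {π : R} (hπ0 : π ≠ 0)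
    (hπu : ¬ IsUnit π) (hunif : IsLocalRing.maximalIdeal R = Ideal.span {π}) (e : ℕ → ℕ)
    (he : StrictMono e) (he0 : 0 < e 0)
    (hkill : ∀ k, ∀ r ∈ IsLocalRing.maximalIdeal R ^ e k, ∀ x : N k, r • x = 0)
    (hker : ∀ k, LinearMap.ker (T.red k) =
      (IsLocalRing.maximalIdeal R ^ e k) • (⊤ : Submodule R (N (k + 1))))
    (hπ : π ∈ IsLocalRing.maximalIdeal R) (hle : ∀ k, e k ≤ e (k + 1))
    (hFsmul : ∀ k (r : R), ∀ y ∈ (F k).selmerGroup,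
      galoisCohomology.scalarMapH1 (T.ρ k) (T.hlin k) r y ∈ (F k).selmerGroup)
    (hFred : ∀ k, ∀ y ∈ (F (k + 1)).selmerGroup, T.redH1 k y ∈ (F k).selmerGroup)
    (hFinc : ∀ k, ∀ y ∈ (F k).selmerGroup, T.incH1 π e hkill hker hπ hle k y ∈ (F (k + 1)).selmerGroup)
    (hFinj : ∀ k, ∀ y ∈ (F k).selmerGroup, T.incH1 π e hkill hker hπ hle k y = 0 → y = 0)
    {M : ℕ → Type} [∀ k, AddCommGroup (M k)] [∀ k, Module R (M k)] (c : ℕ)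
    (hM : ∀ k (m : M k), π ^ c • m = 0)
    (θ : ∀ k, ↥((F k).selmerGroup) ≃+ (R ⧸ IsLocalRing.maximalIdeal R ^ e k) × (M k × M k))
    (hθ : ∀ k (r : R) (y : galoisCohomology (T.ρ k) 1) (hy : y ∈ (F k).selmerGroup),
      θ k ⟨galoisCohomology.scalarMapH1 (T.ρ k) (T.hlin k) r y, hFsmul k r y hy⟩ = r • θ k ⟨y, hy⟩) :
    ∃ x : ∀ k, galoisCohomology (T.ρ k) 1, T.IsFreeRankOneOn (T.limitSelmer F) x := by
  obtain ⟨x, hx, -⟩ := T.exists_isFreeRankOneOn_of_levelwise' F hπ0 hπu hunif e he he0 hkill hker hπ hle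
    hFsmul hFred hFinc hFinj c hM θ hθ
  exact ⟨x, hx⟩

end AdicTower

end ConclusionOne

/-! ## §H. Conclusion (i) on a `DVRSetting` MODULO the printed inputs (Lemma 1.3.3; Thm. 1.4.2 with `ε = 1`) -/

section ConclusionOneDVR

namespace DVRSetting

variable {p : ℕ} [Fact p.Prime] {K : Type} [Field K] [NumberField K]
  {R : Type} [CommRing R] [IsDomain R] [IsDiscreteValuationRing R] [Algebra ℤ_[p] R]
  {N : ℕ → Type} [∀ k, AddCommGroup (N k)] [∀ k, TopologicalSpace (N k)]
  [∀ k, DiscreteTopology (N k)] [∀ k, Module R (N k)]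
  {Rk : ℕ → Type} [∀ k, CommRing (Rk k)] [∀ k, IsLocalRing (Rk k)] [∀ k, TopologicalSpace (Rk k)]
  [∀ k, DiscreteTopology (Rk k)] [∀ k, Algebra ℤ_[p] (Rk k)] [∀ k, Algebra R (Rk k)]
  [∀ k, Module (Rk k) (N k)] [∀ k, IsScalarTower R (Rk k) (N k)]
  {Nbar : Type} [AddCommGroup Nbar] [TopologicalSpace Nbar] [DiscreteTopology Nbar]
  [∀ k, Module (Rk k) Nbar]
  {Nq : ℕ → Finset (HeightOneSpectrum (𝓞 K)) → Type} [∀ k n, AddCommGroup (Nq k n)]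
  [∀ k n, TopologicalSpace (Nq k n)] [∀ k n, DiscreteTopology (Nq k n)]
  [∀ k n, Module (Rk k) (Nq k n)] [∀ k n, Module R (Nq k n)]
  [∀ k n, IsScalarTower R (Rk k) (Nq k n)]

/-- The level Selmer groups `H¹_F(K, T^{(k)})` are `R`-stable (the local conditions are `R`-submodules,
`SatisfiesH.cond_smul`, and localisation is `R`-linear).
[cite: Howard2004HeegnerKolyvagin, Def. 1.1.1 and Def. 1.1.10 (arXiv p. 5 L20–21, p. 6 L14–24)] -/
theorem scalarMapH1_mem_selmerGroup (S : DVRSetting p K R N Rk Nbar Nq) (hy : S.SatisfiesH) (k : ℕ)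
    (r : R) {y : galoisCohomology (S.T.ρ k) 1} (hy' : y ∈ ((S.t k).cond).selmerGroup) :
    galoisCohomology.scalarMapH1 (S.T.ρ k) (S.T.hlin k) r y ∈ ((S.t k).cond).selmerGroup := by
  rw [SelmerStructure.mem_selmerGroup_iff] at hy' ⊢
  intro v
  rw [galoisCohomology.localization_scalarMapH1]
  exact hy.cond_smul k v r ⟨_, hy' v, rfl⟩

/-- The reductions carry `H¹_F(K, T^{(k+1)})` into `H¹_F(K, T^{(k)})` (the level conditions are the
reductions of each other, `SatisfiesH.cond_red`, and localisation is natural).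
[cite: Howard2004HeegnerKolyvagin, Def. 1.1.3 and §1.6 (arXiv p. 5 L93–99; p. 12 L29–33)] -/
theorem redH1_mem_selmerGroup (S : DVRSetting p K R N Rk Nbar Nq) (hy : S.SatisfiesH) (k : ℕ)
    {y : galoisCohomology (S.T.ρ (k + 1)) 1} (hy' : y ∈ ((S.t (k + 1)).cond).selmerGroup) :
    S.T.redH1 k y ∈ ((S.t k).cond).selmerGroup := by
  rw [SelmerStructure.mem_selmerGroup_iff] at hy' ⊢
  intro v
  have h := localization_cohomologyMap_one (S.T.ρ (k + 1)) (S.T.ρ k) (S.T.red k).toAddMonoidHom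
    (S.T.red_equivariant k) v y
  show galoisCohomology.localization (S.T.ρ k) v 1 (ContinuousRep.cohomologyMap (S.T.ρ (k + 1))
    (S.T.ρ k) (S.T.red k).toAddMonoidHom continuous_of_discreteTopology (S.T.red_equivariant k) 1 y) ∈
    (S.t k).cond v
  rw [h, ← hy.cond_red k v]
  exact AddSubgroup.mem_map_of_mem _ (hy' v)

/-- **Thm. 1.6.1, conclusion (i) «`H¹_F(K, T)` is a free rank-one `R`-module» on a `DVRSetting`
satisfying H.0–H.5, MODULO the two printed inputs it rests on** — Lemma 1.3.3 (in the part used: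
`H¹(inc)` maps `H¹_F(K, T^{(k)})` injectively into `H¹_F(K, T^{(k+1)})`) and Thm. 1.4.2 + Prop. 1.5.5 with
`ε = 1` (additive `R`-equivariant `H¹_F(K, T^{(k)}) ≅ R/𝔪^{e_k} ⊕ M_k ⊕ M_k`, the `M_k` killed by a fixed
`π^c` — in the printed proof `ε = 1` and `λ^{(k)} < e_k` are forced by Lemma 1.6.4 with `κ_1 ≠ 0`, §B),
taken as hypotheses.  Everything else (the coefficient ring is complete, `𝔪 = (π)`, exact tower,
`R`-stability and reduction-compatibility of the Selmer groups) is discharged from `SatisfiesH`.  This is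
conclusion (i) of `DVRSetting.Conclusion` only; `thm161_dvrKolyvaginBound` is NOT proved here.  The primed
form also returns the levelwise annihilators `ann(x_k) = 𝔪^{e_k}`.
[cite: Howard2004HeegnerKolyvagin, Thm. 1.6.1, proof (arXiv p. 12, L36–46 and L50–55)] -/
theorem exists_isFreeRankOneOn_of_printedInputs' (S : DVRSetting p K R N Rk Nbar Nq)
    (hy : S.SatisfiesH) (hπm : S.π ∈ IsLocalRing.maximalIdeal R) (hle : ∀ k, S.e k ≤ S.e (k + 1))
    (hFinc : ∀ k, ∀ y ∈ ((S.t k).cond).selmerGroup,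
      S.T.incH1 S.π S.e hy.killed hy.ker_red hπm hle k y ∈ ((S.t (k + 1)).cond).selmerGroup)
    (hFinj : ∀ k, ∀ y ∈ ((S.t k).cond).selmerGroup,
      S.T.incH1 S.π S.e hy.killed hy.ker_red hπm hle k y = 0 → y = 0)
    {M : ℕ → Type} [∀ k, AddCommGroup (M k)] [∀ k, Module R (M k)] (c : ℕ)
    (hM : ∀ k (m : M k), S.π ^ c • m = 0)
    (θ : ∀ k, ↥(((S.t k).cond).selmerGroup) ≃+ (R ⧸ IsLocalRing.maximalIdeal R ^ S.e k) × (M k × M k))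
    (hθ : ∀ k (r : R) (y : galoisCohomology (S.T.ρ k) 1) (hy' : y ∈ ((S.t k).cond).selmerGroup),
      θ k ⟨galoisCohomology.scalarMapH1 (S.T.ρ k) (S.T.hlin k) r y,
          S.scalarMapH1_mem_selmerGroup hy k r hy'⟩ = r • θ k ⟨y, hy'⟩) :
    ∃ x : ∀ k, galoisCohomology (S.T.ρ k) 1,
      S.T.IsFreeRankOneOn (S.T.limitSelmer fun k => (S.t k).cond) x ∧
      ∀ k, ∀ r : R, galoisCohomology.scalarMapH1 (S.T.ρ k) (S.T.hlin k) r (x k) = 0 ↔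
        r ∈ IsLocalRing.maximalIdeal R ^ S.e k := by
  haveI : IsAdicComplete (IsLocalRing.maximalIdeal R) R := hy.coeffRing.isAdicComplete
  have hπ0 : S.π ≠ 0 := fun h =>
    IsDiscreteValuationRing.not_a_field R (by rw [hy.unif, h, Ideal.span_singleton_eq_bot])
  have hπu : ¬ IsUnit S.π := (IsLocalRing.mem_maximalIdeal _).mp hπm
  exact S.T.exists_isFreeRankOneOn_of_levelwise' (fun k => (S.t k).cond) hπ0 hπu hy.unif S.e
    hy.e_strictMono hy.e_zero hy.killed hy.ker_red hπm hle
    (fun k r y hy' => S.scalarMapH1_mem_selmerGroup hy k r hy')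
    (fun k y hy' => S.redH1_mem_selmerGroup hy k hy') hFinc hFinj c hM θ hθ

/-- `exists_isFreeRankOneOn_of_printedInputs'` without the levelwise annihilators: conclusion (i) of
`DVRSetting.Conclusion` modulo the printed inputs.
[cite: Howard2004HeegnerKolyvagin, Thm. 1.6.1, proof (arXiv p. 12, L36–46)] -/
theorem exists_isFreeRankOneOn_of_printedInputs (S : DVRSetting p K R N Rk Nbar Nq)
    (hy : S.SatisfiesH) (hπm : S.π ∈ IsLocalRing.maximalIdeal R) (hle : ∀ k, S.e k ≤ S.e (k + 1))
    (hFinc : ∀ k, ∀ y ∈ ((S.t k).cond).selmerGroup,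
      S.T.incH1 S.π S.e hy.killed hy.ker_red hπm hle k y ∈ ((S.t (k + 1)).cond).selmerGroup)
    (hFinj : ∀ k, ∀ y ∈ ((S.t k).cond).selmerGroup,
      S.T.incH1 S.π S.e hy.killed hy.ker_red hπm hle k y = 0 → y = 0)
    {M : ℕ → Type} [∀ k, AddCommGroup (M k)] [∀ k, Module R (M k)] (c : ℕ)
    (hM : ∀ k (m : M k), S.π ^ c • m = 0)
    (θ : ∀ k, ↥(((S.t k).cond).selmerGroup) ≃+ (R ⧸ IsLocalRing.maximalIdeal R ^ S.e k) × (M k × M k))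
    (hθ : ∀ k (r : R) (y : galoisCohomology (S.T.ρ k) 1) (hy' : y ∈ ((S.t k).cond).selmerGroup),
      θ k ⟨galoisCohomology.scalarMapH1 (S.T.ρ k) (S.T.hlin k) r y,
          S.scalarMapH1_mem_selmerGroup hy k r hy'⟩ = r • θ k ⟨y, hy'⟩) :
    ∃ x : ∀ k, galoisCohomology (S.T.ρ k) 1,
      S.T.IsFreeRankOneOn (S.T.limitSelmer fun k => (S.t k).cond) x := by
  obtain ⟨x, hx, -⟩ := S.exists_isFreeRankOneOn_of_printedInputs' hy hπm hle hFinc hFinj c hM θ hθ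
  exact ⟨x, hx⟩

end DVRSetting

end ConclusionOneDVR

/-! ## §I. Conclusion (iii) (the length bound), levelwise, MODULO the printed inputs (p. 12 L50–55) -/

section ConclusionThreeDVR

namespace DVRSetting

variable {p : ℕ} [Fact p.Prime] {K : Type} [Field K] [NumberField K]
  {R : Type} [CommRing R] [IsDomain R] [IsDiscreteValuationRing R] [Algebra ℤ_[p] R]
  {N : ℕ → Type} [∀ k, AddCommGroup (N k)] [∀ k, TopologicalSpace (N k)]
  [∀ k, DiscreteTopology (N k)] [∀ k, Module R (N k)]
  {Rk : ℕ → Type} [∀ k, CommRing (Rk k)] [∀ k, IsLocalRing (Rk k)] [∀ k, TopologicalSpace (Rk k)]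
  [∀ k, DiscreteTopology (Rk k)] [∀ k, Algebra ℤ_[p] (Rk k)] [∀ k, Algebra R (Rk k)]
  [∀ k, Module (Rk k) (N k)] [∀ k, IsScalarTower R (Rk k) (N k)]
  {Nbar : Type} [AddCommGroup Nbar] [TopologicalSpace Nbar] [DiscreteTopology Nbar]
  [∀ k, Module (Rk k) Nbar]
  {Nq : ℕ → Finset (HeightOneSpectrum (𝓞 K)) → Type} [∀ k n, AddCommGroup (Nq k n)]
  [∀ k n, TopologicalSpace (Nq k n)] [∀ k n, DiscreteTopology (Nq k n)]
  [∀ k n, Module (Rk k) (Nq k n)] [∀ k n, Module R (Nq k n)]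
  [∀ k n, IsScalarTower R (Rk k) (Nq k n)]

/-- **Thm. 1.6.1, conclusions (i) and (iii) together, MODULO the printed inputs**: on a `DVRSetting` with
H.0–H.5 and a Kolyvagin system with `κ_1 ≠ 0`, given Lemma 1.3.3 (the part used) and Thm. 1.4.2 /
Prop. 1.5.5 with `ε = 1` (as in `exists_isFreeRankOneOn_of_printedInputs`, the `M_k` finite) AND
Lemma 1.6.4 at `n = 1` («`κ_1^{(k)} ∈ Stub^{(k)} = 𝔪^{len M_k} H¹_F(K, T^{(k)})`»), there is a generator
`x` of the free rank-one `H¹_F(K, T)` such that for all `k ≫ 0` and every `r₁` with `κ_1 = r₁ · x`: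
`len_R M_k ≤ len_R (R ⧸ r₁R)` — the bound of `DVRSetting.Conclusion` (iii) for the level structure
modules (the `M` of conclusion (ii) is one of them).  Proof = the printed closing lines: `κ_1^{(k)} ≠ 0`
for `k ≫ 0` (§A) forces `len M_k ≤ e_k`; `r₁ = u π^a` in the DVR; the levelwise annihilator
`ann(x_k) = 𝔪^{e_k}` («injectivity of `H¹_F(K,T)/𝔪^k → H¹_F(K,T^{(k)})`») and §C give `len M_k ≤ a`.
`thm161_dvrKolyvaginBound` is NOT proved here (conclusion (ii) and the printed inputs remain).
[cite: Howard2004HeegnerKolyvagin, Thm. 1.6.1, proof (arXiv p. 12, L29–31 and L50–55)] -/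
theorem exists_isFreeRankOneOn_length_le_of_printedInputs (S : DVRSetting p K R N Rk Nbar Nq)
    (κ : S.KolyvaginSystem) (hy : S.SatisfiesH) (hπm : S.π ∈ IsLocalRing.maximalIdeal R)
    (hle : ∀ k, S.e k ≤ S.e (k + 1))
    (hFinc : ∀ k, ∀ y ∈ ((S.t k).cond).selmerGroup,
      S.T.incH1 S.π S.e hy.killed hy.ker_red hπm hle k y ∈ ((S.t (k + 1)).cond).selmerGroup)
    (hFinj : ∀ k, ∀ y ∈ ((S.t k).cond).selmerGroup,
      S.T.incH1 S.π S.e hy.killed hy.ker_red hπm hle k y = 0 → y = 0)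
    {M : ℕ → Type} [∀ k, AddCommGroup (M k)] [∀ k, Module R (M k)] [∀ k, Finite (M k)] (c : ℕ)
    (hM : ∀ k (m : M k), S.π ^ c • m = 0)
    (θ : ∀ k, ↥(((S.t k).cond).selmerGroup) ≃+ (R ⧸ IsLocalRing.maximalIdeal R ^ S.e k) × (M k × M k))
    (hθ : ∀ k (r : R) (y : galoisCohomology (S.T.ρ k) 1) (hy' : y ∈ ((S.t k).cond).selmerGroup),
      θ k ⟨galoisCohomology.scalarMapH1 (S.T.ρ k) (S.T.hlin k) r y,
          S.scalarMapH1_mem_selmerGroup hy k r hy'⟩ = r • θ k ⟨y, hy'⟩)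
    (h164 : ∀ k, ∃ y ∈ ((S.t k).cond).selmerGroup,
      κ.one k = galoisCohomology.scalarMapH1 (S.T.ρ k) (S.T.hlin k)
        (S.π ^ (Module.length R (M k)).toNat) y)
    (hone : κ.one ≠ 0) :
    ∃ x : ∀ k, galoisCohomology (S.T.ρ k) 1,
      S.T.IsFreeRankOneOn (S.T.limitSelmer fun k => (S.t k).cond) x ∧
      ∃ k₀ : ℕ, ∀ k, k₀ ≤ k → ∀ r₁ : R, κ.one = S.T.smulFamily r₁ x →
        Module.length R (M k) ≤ Module.length R (R ⧸ Ideal.span {r₁}) := by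
  obtain ⟨x, hx, hxlev⟩ := S.exists_isFreeRankOneOn_of_printedInputs' hy hπm hle hFinc hFinj c hM θ hθ
  obtain ⟨k₀, hk₀⟩ := κ.exists_forall_le_one_apply_ne_zero hone
  refine ⟨x, hx, k₀, fun k hk r₁ hr₁ => ?_⟩
  letI : Module R (galoisCohomology (S.T.ρ k) 1) := galoisCohomology.moduleH1 (S.T.ρ k) (S.T.hlin k)
  have hsmul : ∀ (r : R) (y : galoisCohomology (S.T.ρ k) 1),
      r • y = galoisCohomology.scalarMapH1 (S.T.ρ k) (S.T.hlin k) r y := fun r y => rfl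
  have hirr : Irreducible S.π := (IsDiscreteValuationRing.irreducible_iff_uniformizer S.π).mpr hy.unif
  have hr₁k : κ.one k = r₁ • x k := by rw [hsmul, ← AdicTower.smulFamily_apply]; exact congr_fun hr₁ k
  -- `r₁ ≠ 0` since `κ_1^{(k)} ≠ 0`
  have hr₁0 : r₁ ≠ 0 := by
    rintro rfl
    exact hk₀ k hk (by rw [hr₁k, zero_smul])
  obtain ⟨a, u, hu⟩ := IsDiscreteValuationRing.eq_unit_mul_pow_irreducible hr₁0 hirr
  -- `λ_k = len M_k` as a natural number
  haveI : IsArtinian R (M k) := isArtinian_of_finite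
  have hlen : Module.length R (M k) = ((Module.length R (M k)).toNat : ℕ∞) :=
    (ENat.coe_toNat Module.length_ne_top).symm
  obtain ⟨y, -, hy1⟩ := h164 k
  -- `H¹(K, T^{(k)})` is killed by `π^{e_k}`
  have hkill : ∀ h : galoisCohomology (S.T.ρ k) 1, S.π ^ S.e k • h = 0 := fun h =>
    galoisCohomology.smul_eq_zero_of_forall (S.T.ρ k) (S.T.hlin k) _
      (fun m => hy.killed k _ (Ideal.pow_mem_pow hπm _) m) h
  -- `λ_k ≤ e_k`, else `κ_1^{(k)} = π^{λ_k} y = 0`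
  have hlam_le : (Module.length R (M k)).toNat ≤ S.e k := by
    by_contra hlt
    push Not at hlt
    apply hk₀ k hk
    rw [hy1, ← hsmul, ← Nat.sub_add_cancel hlt.le, pow_add, mul_smul, hkill, smul_zero]
  -- the levelwise annihilator of `x_k` is `𝔪^{e_k} = (π^{e_k})`
  have hxann : ∀ r : R, r • x k = 0 → S.π ^ S.e k ∣ r := fun r hr => by
    have h := (hxlev k r).mp (by rw [← hsmul]; exact hr)
    rwa [hy.unif, Ideal.span_singleton_pow, Ideal.mem_span_singleton] at h
  have hmem : ∃ y' : galoisCohomology (S.T.ρ k) 1,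
      ((u : R) * S.π ^ a) • x k = S.π ^ (Module.length R (M k)).toNat • y' :=
    ⟨y, by rw [← hu, ← hr₁k, hy1, hsmul]⟩
  rw [hu]
  exact length_le_length_quotient_of_stub hirr hlen hlam_le hkill hxann (Units.isUnit u) hmem

end DVRSetting

end ConclusionThreeDVR

end Literature.NumberTheory.GaloisCohomology.Howard2004
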